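import Literature.NumberTheory.Sieve.ChenTheorem
import Literature.NumberTheory.Sieve.ChenTwinSieveLower
import Literature.NumberTheory.Sieve.RosserSieveTheoremOneHalfLt
import Literature.NumberTheory.Sieve.BetaSieveSmallDimension
import Literature.NumberTheory.Sieve.LinearSieveConstant
import Literature.NumberTheory.Sieve.JurkatRichertRefutation
import Literature.NumberTheory.Sieve.RosserSieveBetaOneInduction
import Literature.NumberTheory.Sieve.ParityBarrierLevelProofs
import Literature.NumberTheory.Sieve.ChenTwinSieveLowerHolds
import Literature.NumberTheory.Sieve.ChenSwitchingLinearSieve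
import HarnessLib

/-!
# Chen's theorem: the upper bound for `∑_q S(A_q, 𝒫, z)` (Nathanson, Thm 10.5) — PROVED

Topic `Literature/NumberTheory/Sieve`; companion of `ChenTheorem.lean`, which vendors the
architecture of the printed proof of Chen's theorem `N = p + P₂` (Nathanson, *Additive Number
Theory: The Classical Bases*, GTM 164, Ch. 10) as named facts. This file DISCHARGES one of them,
`Literature.NumberTheory.Sieve.Chen.chen_siftedDvd_upper` (Thm 10.5): for every `ε > 0` and all large
even `N`, with `z = N^{1/8}`, `y = N^{1/3}`, `V(z) = ∏_{p<z, p∤N} (1 − 1/(p−1))`,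

  `∑_{z ≤ q < y} S(A_q, 𝒫, z) < (e^γ log 6 / 2 + ε) · N V(z) / log N`

(`chen_siftedDvd_upper_holds`). Everything in this file is proved; the deep inputs are theorems of
the tree: the LINEAR SIEVE UPPER BOUND (Nathanson's Thms 9.7–9.8 = Jurkat–Richert) in the proved
form of Iwaniec's Theorem 1 (`Iwaniec1980_thm1_upper_of_half_lt`, `κ = 1`, with `F_1(s) = 2e^γ/s`
on `(0, 3]`, `upperSieveFun_one_eq_holds`), the BOMBIERI–VINOGRADOV THEOREM
(`BombieriVinogradovStatement_holds`, `π`-form `eventually_sum_abs_primeCountingDisc_le`), the prime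
number theorem (`eventually_primeCounting_bounds`) and Mertens' product theorem with rate
(`PairProducts.abs_log_mertensProd_sub_le`, `sieveProduct_two_ge`).

## The proof (Nathanson pp. 172–175 of the held copy), as adapted to the tree

* §10.3, (9.33)–(9.34): the density `g_N(d) = 1/φ(d)` for `(d, N) = 1` (`0` otherwise;
  `shiftedPrimesDensity N`) satisfies Iwaniec's regular dimension condition `Ω(1, L₀)` with an
  ABSOLUTE `L₀ = 54 e^{54/log 2}`, uniformly in the even number `N` (the tree's
  `hasIwaniecDimension_shiftedPrimesDensity`, `ChenSwitchingLinearSieve.lean`, and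
  `hasIwaniecDimension_shiftedPrimesDensity_two`, `ChenTwinSieveLowerHolds.lean`): `(1 − 1/(p−1))⁻¹ = (1 − 1/p)⁻¹(1 + 1/(p(p−2)))`
  (p. 170) and Mertens with rate.
* p. 172–173: for a prime `z ≤ q < y` with `q ∣ N`, `S(A_q, 𝒫, z) = 0`
  (`siftedCountDvd_eq_zero_of_dvd`); for `q ∤ N` the sifted sequence `A_q` (`goldbachSeq N q`:
  weights `1_𝒜(n) 1_{q∣n}`, `𝒜 = {N − p : p ≤ N, p ∤ N}`, density `g_N`, size `X_q = π(N)/(q − 1)`)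
  has `S(A_q, z; N) = S(A_q, 𝒫, z)` (`sifted_goldbachSeq_eq`: elements of `𝒜` are coprime to `N`,
  so sifting by all primes `< z` is sifting by `𝒫`), `V = V(z)` (`densityProduct_goldbachSeq_eq`),
  and for `d ∣ P(z)`: `R_d = 0` if `(d, N) > 1`, `|R_d| ≤ |π(N; qd, N) − π(N)/φ(qd)| + ω(N)` if
  `(d, N) = 1` (`abs_remainder_goldbachSeq_le`; Nathanson's `r_q(d) = r(qd) − r(q)/φ(d)` is
  avoided by the choice `X_q = π(N) g(q)` instead of `|A_q|`, which the sieve theorem permits).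
  The linear sieve (`linearSieve_upper_le`) with level `D_q = N^{1/2−κ}/q ≥ z` gives
  `S(A_q, 𝒫, z) ≤ X_q V(z) (2e^γ/s_q + C (log D_q)^{−1/3}) + ∑_{d<D_q, d∣P(z)} |R_d|`,
  `s_q = log D_q/log z = 8(1/2 − κ − log q/log N) ≤ 3`, and
  `2e^γ/s_q ≤ (e^γ/4)(1 − 6κ)⁻¹/(1/2 − log q/log N)` (`siftedCountDvd_le_of_sieve`). (A power level
  `N^{1/2−κ}` replaces Nathanson's `N^{1/2}(log N)^{−B−1}` because the tree's Bombieri–Vinogradov is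
  in the `θ < 1/2` form; the loss `1 + O(κ)` in `F(s_q)` is absorbed in `ε`.)
* p. 173, `R'`: the moduli `qd` are distinct (`q` is the unique prime factor `≥ z`), so
  `∑_q ∑_d |R_d| ≤ ∑_{m ≤ N^{1/2−κ}} |π(N; m, N) − π(N)/φ(m)| + N^{1/2−κ} ω(N) ≪ N/(log N)³`
  (`remainderSum_goldbachSeq_le`, `sum_remainderSum_le`, Bombieri–Vinogradov with `A = 3`,
  `ω(N) ≤ 2 log N`), which is `≤ κ N V(z)/log N` since `V(z) ≥ 16e^{−7}/log N`
  (`remainderBudget_le`).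
* pp. 174–175, the main term: `π(N) ≤ (1+κ) N/log N` and
  `∑_{z≤q<y} g(q)/(1/2 − log q/log N) ≤ 2 log 6 + κ` for large `N`
  (`sum_midPrimes_density_mul_phi_le`; Nathanson: `∑ 1/(q log(N^{1/2}/q)) =
  (1/log N)∫_{1/8}^{1/3} dα/(α(1/2 − α)) + O((log N)^{−2}) = 2 log 6/log N`). Here this is the
  upper Riemann–Stieltjes bound from `Ω(1, L₀)` alone (`∑_{u≤p<v} g(p) ≤ log(log v/log u) + L₀/log u`,
  `BetaSieve.sum_primes_g_le`) over `K` equal pieces of `[1/8, 1/3]`, with the telescoping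
  comparison `log(t/s)/(1/2 − t) ≤ (1 + 8(t−s))(1 + 6(t−s))(G(t) − G(s))`,
  `G(t) = 2 log(t/(1/2 − t))`, `G(1/3) − G(1/8) = 2 log 6` (`riemannTerm_le`,
  `riemannG_one_third_sub_one_eighth`); and `∑_q g(q) ≤ 3` (`sum_midPrimes_density_le`).
* Bookkeeping (`sum_siftedCountDvd_le_of`, `mainTerm_numeric_le`): with `0 < κ ≤ min(ε,1)/100` the
  total is `≤ (e^γ log 6/2 + 25κ) N V(z)/log N < (e^γ log 6/2 + ε) N V(z)/log N`.

## References

* M. B. Nathanson, *Additive Number Theory: The Classical Bases*, GTM 164, Springer (1996), §10.3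
  and Thm 10.5 with its proof (PDF pp. 169–170, 172–175 of the held copy). [Nathanson1996]
* H. Iwaniec, *Rosser's sieve*, Acta Arith. 36 (1980), 171–202, Theorem 1. [IwaniecActaArith1980]
* G. H. Hardy, E. M. Wright, *An Introduction to the Theory of Numbers*, Thm 429. [HardyWright2008]
-/

open Finset Filter

noncomputable section

namespace Literature.NumberTheory.Sieve.Chen

/-! ### The mass of a window of primes under `g₂(p) = 1/(p − 1)` (from `Ω(1, L₀)`) -/

/-- `0 ≤ L₀ = 54 e^{54/log 2}`, the absolute constant of the dimension condition `Ω(1, L₀)`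
satisfied by `g(d) = 1/φ(d)` (`hasIwaniecDimension_shiftedPrimesDensity_two`,
`hasIwaniecDimension_shiftedPrimesDensity` of the tree). [folklore] -/
theorem linearDimConst_nonneg : (0 : ℝ) ≤ 54 * Real.exp (54 / Real.log 2) := by positivity

/-- The mass of the primes of `[u, v)` under `g₂` (`g₂(p) = 1/(p−1)` for odd `p`, `g₂(2) = 0`):
`∑_{u ≤ p < v} g₂(p) ≤ log(log v/log u) + L₀/log u` for `2 ≤ u ≤ v` (Mertens, through the dimension
condition `Ω(1, L₀)` of the tree, `hasIwaniecDimension_shiftedPrimesDensity_two`, and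
`BetaSieve.sum_primes_g_le`). [cite: Nathanson1996, Thm 6.7 (as used on p. 174)] -/
theorem sum_shiftedPrimesDensity_two_le {u v : ℝ} (hu : 2 ≤ u) (huv : u ≤ v) :
    ∑ p ∈ (Nat.primesBelow ⌈v⌉₊).filter (fun p : ℕ => u ≤ (p : ℝ)), shiftedPrimesDensity 2 p ≤
      Real.log (Real.log v / Real.log u) + 54 * Real.exp (54 / Real.log 2) / Real.log u := by
  have := BetaSieve.sum_primes_g_le hasIwaniecDimension_shiftedPrimesDensity_two hu huv
  simpa using this

/-! ### The main-term sum over the primes `N^{1/8} ≤ q < N^{1/3}` (Nathanson pp. 174–175)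

With `φ(τ) = 1/(1/2 − τ)` and `τ_q = log q/log N` one has `F(s_q) = 2e^γ/s_q = (e^γ/4) φ(τ_q)` for
the level `D_q = N^{1/2}/q`, and Nathanson evaluates `∑_q φ(τ_q)/q ∼ log N ∫_{1/8}^{1/3} dα/(α(1/2 − α))
= 2 log 6`. We prove the upper bound `∑_q g₂(q) φ(τ_q) ≤ 2 log 6 + δ` (`N ≥ N₀(δ)`) by an upper
Riemann–Stieltjes sum over `K` equal pieces of `[1/8, 1/3]`, the mass of each piece being controlled
by `Ω(1, L₀)` (`sum_shiftedPrimesDensity_two_le`), and the telescoping comparison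
`φ(t) log(t/s) ≤ (1 + 8(t−s))(1 + 6(t−s)) (G(t) − G(s))`, `G(t) = 2 log(t/(1/2 − t))`,
`G(1/3) − G(1/8) = 2 log 6`. -/

/-- The primes of a piece `[N^s, N^t)`. [folklore] -/
theorem mem_piece_iff {N : ℕ} {s t : ℝ} {q : ℕ} :
    q ∈ (Nat.primesBelow ⌈(N : ℝ) ^ t⌉₊).filter (fun q : ℕ => (N : ℝ) ^ s ≤ q) ↔
      q.Prime ∧ (N : ℝ) ^ s ≤ q ∧ (q : ℝ) < (N : ℝ) ^ t := by
  rw [Finset.mem_filter, Nat.mem_primesBelow, Nat.lt_ceil]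
  tauto

/-- Splitting a piece at an intermediate exponent: `[N^s, N^t) = [N^s, N^m) ⊔ [N^m, N^t)` for
`s ≤ m ≤ t` (`N ≥ 1`). [folklore] -/
theorem sum_piece_split {N : ℕ} (hN1 : 1 ≤ (N : ℝ)) {s m t : ℝ} (hsm : s ≤ m) (hmt : m ≤ t)
    (f : ℕ → ℝ) :
    ∑ q ∈ (Nat.primesBelow ⌈(N : ℝ) ^ t⌉₊).filter (fun q : ℕ => (N : ℝ) ^ s ≤ q), f q =
      ∑ q ∈ (Nat.primesBelow ⌈(N : ℝ) ^ m⌉₊).filter (fun q : ℕ => (N : ℝ) ^ s ≤ q), f q +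
        ∑ q ∈ (Nat.primesBelow ⌈(N : ℝ) ^ t⌉₊).filter (fun q : ℕ => (N : ℝ) ^ m ≤ q), f q := by
  have hsm' : (N : ℝ) ^ s ≤ (N : ℝ) ^ m := Real.rpow_le_rpow_of_exponent_le hN1 hsm
  have hmt' : (N : ℝ) ^ m ≤ (N : ℝ) ^ t := Real.rpow_le_rpow_of_exponent_le hN1 hmt
  rw [← Finset.sum_filter_add_sum_filter_not
    ((Nat.primesBelow ⌈(N : ℝ) ^ t⌉₊).filter (fun q : ℕ => (N : ℝ) ^ s ≤ q))
    (fun q : ℕ => (N : ℝ) ^ m ≤ q) f, add_comm]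
  congr 1
  · congr 1
    ext q
    simp only [Finset.mem_filter, Nat.mem_primesBelow, Nat.lt_ceil, not_le]
    constructor
    · rintro ⟨⟨⟨-, hp⟩, hs⟩, hm⟩
      exact ⟨⟨hm, hp⟩, hs⟩
    · rintro ⟨⟨hm, hp⟩, hs⟩
      exact ⟨⟨⟨lt_of_lt_of_le hm hmt', hp⟩, hs⟩, hm⟩
  · congr 1
    ext q
    simp only [Finset.mem_filter, Nat.mem_primesBelow, Nat.lt_ceil]
    constructor
    · rintro ⟨⟨⟨ht, hp⟩, -⟩, hm⟩
      exact ⟨⟨ht, hp⟩, hm⟩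
    · rintro ⟨⟨ht, hp⟩, hm⟩
      exact ⟨⟨⟨ht, hp⟩, hsm'.trans hm⟩, hm⟩

/-- **One piece of the upper Riemann–Stieltjes sum**: for `0 < s ≤ t < 1/2` and `N^s ≥ 2`,
`∑_{N^s ≤ q < N^t} g₂(q) φ(log q/log N) ≤ φ(t) (log(t/s) + L₀/(s log N))`, `φ(τ) = 1/(1/2 − τ)`
(monotonicity of `φ` and the mass bound `sum_shiftedPrimesDensity_two_le`).
[cite: Nathanson1996, Thm 10.5 (proof, pp. 174–175)] -/
theorem sum_piece_le {N : ℕ} {s t : ℝ} (hN : 2 ≤ (N : ℝ) ^ s) (hs : 0 < s) (hst : s ≤ t)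
    (ht : t < 1 / 2) :
    ∑ q ∈ (Nat.primesBelow ⌈(N : ℝ) ^ t⌉₊).filter (fun q : ℕ => (N : ℝ) ^ s ≤ q),
        shiftedPrimesDensity 2 q * (1 / (1 / 2 - Real.log q / Real.log N)) ≤
      1 / (1 / 2 - t) * (Real.log (t / s) + 54 * Real.exp (54 / Real.log 2) / (s * Real.log N)) := by
  -- `N > 1`
  have hN1 : (1 : ℝ) < N := by
    by_contra h
    rw [not_lt] at h
    have : (N : ℝ) ^ s ≤ 1 := Real.rpow_le_one (Nat.cast_nonneg N) h hs.le
    linarith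
  have hN0 : (0 : ℝ) < N := by linarith
  have hlogN : 0 < Real.log N := Real.log_pos hN1
  have hst' : (N : ℝ) ^ s ≤ (N : ℝ) ^ t := Real.rpow_le_rpow_of_exponent_le hN1.le hst
  have hlogs : Real.log ((N : ℝ) ^ s) = s * Real.log N := Real.log_rpow hN0 s
  have hlogt : Real.log ((N : ℝ) ^ t) = t * Real.log N := Real.log_rpow hN0 t
  set P := (Nat.primesBelow ⌈(N : ℝ) ^ t⌉₊).filter (fun q : ℕ => (N : ℝ) ^ s ≤ q) with hP
  have hφt : 0 < 1 / (1 / 2 - t) := div_pos one_pos (by linarith)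
  -- termwise: `φ(τ_q) ≤ φ(t)`
  have hterm : ∀ q ∈ P, shiftedPrimesDensity 2 q * (1 / (1 / 2 - Real.log q / Real.log N)) ≤
      shiftedPrimesDensity 2 q * (1 / (1 / 2 - t)) := by
    intro q hq
    obtain ⟨hqp, hsq, hqt⟩ := mem_piece_iff.mp hq
    have hq0 : (0 : ℝ) < q := by exact_mod_cast hqp.pos
    have hτ : Real.log q / Real.log N < t := by
      rw [div_lt_iff₀ hlogN, ← hlogt]
      exact Real.log_lt_log hq0 hqt
    refine mul_le_mul_of_nonneg_left ?_ (shiftedPrimesDensity_two_prime_mem_Ico hqp).1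
    exact one_div_le_one_div_of_le (by linarith) (by linarith)
  calc ∑ q ∈ P, shiftedPrimesDensity 2 q * (1 / (1 / 2 - Real.log q / Real.log N))
      ≤ ∑ q ∈ P, shiftedPrimesDensity 2 q * (1 / (1 / 2 - t)) := Finset.sum_le_sum hterm
    _ = 1 / (1 / 2 - t) * ∑ q ∈ P, shiftedPrimesDensity 2 q := by
        rw [Finset.mul_sum]
        exact Finset.sum_congr rfl fun q _ => mul_comm _ _
    _ ≤ 1 / (1 / 2 - t) *
          (Real.log (Real.log ((N : ℝ) ^ t) / Real.log ((N : ℝ) ^ s)) +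
            54 * Real.exp (54 / Real.log 2) / Real.log ((N : ℝ) ^ s)) :=
        mul_le_mul_of_nonneg_left (sum_shiftedPrimesDensity_two_le hN hst') hφt.le
    _ = 1 / (1 / 2 - t) * (Real.log (t / s) + 54 * Real.exp (54 / Real.log 2) / (s * Real.log N)) := by
        rw [hlogs, hlogt, mul_div_mul_right _ _ hlogN.ne']

/-- The telescoping comparison of one Riemann term with the antiderivative
`G(t) = 2 (log t − log(1/2 − t))` of `1/(α(1/2 − α))`: for `1/8 ≤ s < t ≤ 1/3`,
`log(t/s)/(1/2 − t) ≤ (1 + 8(t − s))(1 + 6(t − s)) (G(t) − G(s))`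
(`Δ/t ≤ log(t/s) ≤ Δ/s`, `Δ = t − s`). [folklore] -/
theorem riemannTerm_le {s t : ℝ} (hs : 1 / 8 ≤ s) (hst : s < t) (ht : t ≤ 1 / 3) :
    1 / (1 / 2 - t) * Real.log (t / s) ≤
      (1 + 8 * (t - s)) * (1 + 6 * (t - s)) *
        (2 * (Real.log t - Real.log (1 / 2 - t)) - 2 * (Real.log s - Real.log (1 / 2 - s))) := by
  have hs0 : 0 < s := by linarith
  have ht0 : 0 < t := by linarith
  have hs' : 0 < 1 / 2 - s := by linarith
  have ht' : 0 < 1 / 2 - t := by linarith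
  set Δ := t - s with hΔ
  have hΔ0 : 0 < Δ := by rw [hΔ]; linarith
  set A := t * (1 / 2 - s) with hA
  set B := s * (1 / 2 - t) with hB
  have hA0 : 0 < A := mul_pos ht0 hs'
  have hB0 : 0 < B := mul_pos hs0 ht'
  set M := (1 + 8 * Δ) * (1 + 6 * Δ) with hM
  have hM1 : 1 ≤ M := by rw [hM]; nlinarith
  -- the two logarithmic inequalities
  have h1 : Real.log (t / s) ≤ Δ / s := by
    have := Real.log_le_sub_one_of_pos (div_pos ht0 hs0)
    rw [hΔ, sub_div, div_self hs0.ne']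
    exact this
  have h2 : Δ / t ≤ Real.log (t / s) := by
    have := Real.one_sub_inv_le_log_of_pos (div_pos ht0 hs0)
    rw [inv_div] at this
    rw [hΔ, sub_div, div_self ht0.ne']
    exact this
  have h3 : Δ / (1 / 2 - s) ≤ Real.log (1 / 2 - s) - Real.log (1 / 2 - t) := by
    have := Real.one_sub_inv_le_log_of_pos (div_pos hs' ht')
    rw [inv_div, Real.log_div hs'.ne' ht'.ne'] at this
    have e : Δ / (1 / 2 - s) = 1 - (1 / 2 - t) / (1 / 2 - s) := by
      rw [hΔ, eq_sub_iff_add_eq, ← add_div]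
      rw [div_eq_one_iff_eq hs'.ne']
      ring
    rw [e]
    exact this
  -- `G t - G s ≥ Δ / A`
  have hG : Δ / A ≤ 2 * (Real.log t - Real.log (1 / 2 - t)) - 2 * (Real.log s - Real.log (1 / 2 - s)) := by
    have hlog : Real.log (t / s) = Real.log t - Real.log s := Real.log_div ht0.ne' hs0.ne'
    have h2' : Δ / t ≤ Real.log t - Real.log s := hlog ▸ h2
    have key : Δ / A ≤ 2 * (Δ / t + Δ / (1 / 2 - s)) := by
      have e1 : Δ / t = Δ * (1 / 2 - s) / A := by rw [hA, mul_div_mul_right _ _ hs'.ne']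
      have e2 : Δ / (1 / 2 - s) = Δ * t / A := by
        rw [hA, mul_comm t, mul_div_mul_right _ _ ht0.ne']
      rw [e1, e2, ← add_div, ← mul_div_assoc]
      refine div_le_div_of_nonneg_right ?_ hA0.le
      nlinarith
    linarith
  -- `A ≤ M B`
  have hAB : A ≤ M * B := by
    have e1 : t ≤ (1 + 8 * Δ) * s := by rw [hΔ]; nlinarith
    have e2 : 1 / 2 - s ≤ (1 + 6 * Δ) * (1 / 2 - t) := by rw [hΔ]; nlinarith
    calc A = t * (1 / 2 - s) := rfl
      _ ≤ ((1 + 8 * Δ) * s) * ((1 + 6 * Δ) * (1 / 2 - t)) :=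
          mul_le_mul e1 e2 hs'.le (by nlinarith)
      _ = M * B := by rw [hM, hB]; ring
  -- conclude
  calc 1 / (1 / 2 - t) * Real.log (t / s) ≤ 1 / (1 / 2 - t) * (Δ / s) :=
        mul_le_mul_of_nonneg_left h1 (by positivity)
    _ = Δ / B := by rw [hB]; field_simp
    _ ≤ Δ * M / A := by
        rw [div_le_div_iff₀ hB0 hA0]
        nlinarith
    _ = M * (Δ / A) := by ring
    _ ≤ M * (2 * (Real.log t - Real.log (1 / 2 - t)) - 2 * (Real.log s - Real.log (1 / 2 - s))) :=
        mul_le_mul_of_nonneg_left hG (by linarith)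

/-- `G(1/3) − G(1/8) = 2 log 6` (`= ∫_{1/8}^{1/3} dα/(α(1/2 − α))`, Nathanson p. 175).
[cite: Nathanson1996, Thm 10.5 (proof, p. 175)] -/
theorem riemannG_one_third_sub_one_eighth :
    2 * (Real.log (1 / 3 : ℝ) - Real.log (1 / 2 - 1 / 3)) -
        2 * (Real.log (1 / 8 : ℝ) - Real.log (1 / 2 - 1 / 8)) = 2 * Real.log 6 := by
  have h1 : Real.log (1 / 3 : ℝ) - Real.log (1 / 2 - 1 / 3) = Real.log 2 := by
    rw [← Real.log_div (by norm_num) (by norm_num)]; norm_num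
  have h2 : Real.log (1 / 8 : ℝ) - Real.log (1 / 2 - 1 / 8) = -Real.log 3 := by
    rw [← Real.log_div (by norm_num) (by norm_num), ← Real.log_inv]; norm_num
  have h6 : Real.log 6 = Real.log 2 + Real.log 3 := by
    rw [show (6 : ℝ) = 2 * 3 by norm_num, Real.log_mul (by norm_num) (by norm_num)]
  rw [h1, h2, h6]; ring

/-- **The main-term sum of Thm 10.5** (Nathanson pp. 174–175: `(e^γ N/4) ∑_q 1/(φ(q) log(N^{1/2}/q))
= (e^γ log 6/2 + O(ε)) N/log N`), as an upper bound: for every `δ > 0` there is `N₀` with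
`∑_{N^{1/8} ≤ q < N^{1/3}} g₂(q)/(1/2 − log q/log N) ≤ 2 log 6 + δ` for all `N ≥ N₀`
(`g₂(q) = 1/(q − 1) = 1/φ(q)`). [cite: Nathanson1996, Thm 10.5 (proof, pp. 174–175)] -/
theorem sum_midPrimes_density_mul_phi_le {δ : ℝ} (hδ : 0 < δ) :
    ∃ N₀ : ℕ, ∀ N : ℕ, N₀ ≤ N →
      ∑ q ∈ midPrimes (z N) (y N),
          shiftedPrimesDensity 2 q * (1 / (1 / 2 - Real.log q / Real.log N)) ≤
        2 * Real.log 6 + δ := by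
  -- the partition
  set K : ℕ := ⌈25 / δ⌉₊ + 10 with hK
  have hK10 : (10 : ℝ) ≤ K := by
    have : (10 : ℕ) ≤ K := by rw [hK]; omega
    exact_mod_cast this
  have hKpos : (0 : ℝ) < K := by linarith
  have hKδ : 25 / δ ≤ K := by
    have h1 : 25 / δ ≤ ⌈25 / δ⌉₊ := Nat.le_ceil _
    have h2 : ((⌈25 / δ⌉₊ : ℕ) : ℝ) ≤ K := by
      have : ⌈25 / δ⌉₊ ≤ K := by rw [hK]; omega
      exact_mod_cast this
    linarith
  set Δ : ℝ := 5 / 24 / K with hΔ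
  have hΔ0 : 0 < Δ := by positivity
  have hΔ48 : Δ ≤ 1 / 48 := by
    rw [hΔ, div_le_iff₀ hKpos]; nlinarith
  have hΔδ : 120 * Δ ≤ δ := by
    rw [hΔ]
    have : 25 ≤ K * δ := by rwa [div_le_iff₀ hδ] at hKδ
    rw [show (120 : ℝ) * (5 / 24 / K) = 25 / K by field_simp; ring, div_le_iff₀ hKpos]
    linarith
  set T : ℕ → ℝ := fun i => 1 / 8 + i * Δ with hT
  have hT0 : T 0 = 1 / 8 := by simp [hT]
  have hTK : T K = 1 / 3 := by
    simp only [hT, hΔ]; field_simp; ring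
  have hTmono : ∀ i j : ℕ, i ≤ j → T i ≤ T j := fun i j hij => by
    simp only [hT]
    have : (i : ℝ) ≤ j := by exact_mod_cast hij
    nlinarith
  have hTsucc : ∀ i : ℕ, T (i + 1) - T i = Δ := fun i => by
    simp only [hT]; push_cast; ring
  have hTlo : ∀ i : ℕ, 1 / 8 ≤ T i := fun i => hT0 ▸ hTmono 0 i (Nat.zero_le i)
  have hThi : ∀ i : ℕ, i ≤ K → T i ≤ 1 / 3 := fun i hi => hTK ▸ hTmono i K hi
  -- the threshold
  set L₀ : ℝ := 54 * Real.exp (54 / Real.log 2) with hL₀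
  have hL₀0 : (0 : ℝ) ≤ L₀ := linearDimConst_nonneg
  have hlog : Tendsto (fun N : ℕ => Real.log N) atTop atTop :=
    Real.tendsto_log_atTop.comp (tendsto_natCast_atTop_atTop (R := ℝ))
  obtain ⟨N₀, hN₀⟩ := eventually_atTop.mp
    ((hlog.eventually_ge_atTop (96 * K * L₀ / δ + 8)).and (eventually_ge_atTop 256))
  refine ⟨N₀, fun N hN => ?_⟩
  obtain ⟨hlogN, hN256⟩ := hN₀ N hN
  have hN256' : (256 : ℝ) ≤ N := by exact_mod_cast hN256
  have hN1 : (1 : ℝ) ≤ N := by linarith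
  have hN0 : (0 : ℝ) < N := by linarith
  have hlogNpos : 0 < Real.log N := by
    have : (0 : ℝ) ≤ 96 * K * L₀ / δ := by positivity
    linarith
  -- `N^{1/8} ≥ 2`
  have hz2 : (2 : ℝ) ≤ (N : ℝ) ^ (1 / 8 : ℝ) := by
    have h256 : (256 : ℝ) = 2 ^ (8 : ℝ) := by norm_num
    calc (2 : ℝ) = ((2 : ℝ) ^ (8 : ℝ)) ^ (1 / 8 : ℝ) := by
          rw [← Real.rpow_mul (by norm_num)]; norm_num
      _ ≤ (N : ℝ) ^ (1 / 8 : ℝ) := by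
          refine Real.rpow_le_rpow (by positivity) ?_ (by norm_num)
          rw [← h256]; exact hN256'
  -- the bound for the first `k` pieces, by induction
  set f : ℕ → ℝ := fun q => shiftedPrimesDensity 2 q * (1 / (1 / 2 - Real.log q / Real.log N)) with hf
  set Bd : ℕ → ℝ := fun i =>
    1 / (1 / 2 - T (i + 1)) * (Real.log (T (i + 1) / T i) + L₀ / (T i * Real.log N)) with hBd
  have hind : ∀ k : ℕ, k ≤ K →
      ∑ q ∈ (Nat.primesBelow ⌈(N : ℝ) ^ T k⌉₊).filter (fun q : ℕ => (N : ℝ) ^ T 0 ≤ q), f q ≤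
        ∑ i ∈ Finset.range k, Bd i := by
    intro k hk
    induction k with
    | zero =>
      rw [Finset.sum_range_zero]
      have hempty : (Nat.primesBelow ⌈(N : ℝ) ^ T 0⌉₊).filter (fun q : ℕ => (N : ℝ) ^ T 0 ≤ q) = ∅ := by
        refine Finset.filter_eq_empty_iff.mpr fun q hq h => ?_
        exact absurd h (not_le.mpr (Nat.lt_ceil.mp (Nat.mem_primesBelow.mp hq).1))
      rw [hempty, Finset.sum_empty]
    | succ k ih =>
      have hk' : k ≤ K := Nat.le_of_succ_le hk
      rw [sum_piece_split hN1 (hTmono 0 k (Nat.zero_le k)) (hTmono k (k + 1) (Nat.le_succ k)) f,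
        Finset.sum_range_succ]
      refine add_le_add (ih hk') ?_
      have hpow : (2 : ℝ) ≤ (N : ℝ) ^ T k :=
        hz2.trans (Real.rpow_le_rpow_of_exponent_le hN1 (hTlo k))
      have hTk0 : 0 < T k := by linarith [hTlo k]
      have hTk1 : T (k + 1) < 1 / 2 := by linarith [hThi (k + 1) hk]
      exact sum_piece_le hpow hTk0 (hTmono k (k + 1) (Nat.le_succ k)) hTk1
  have hmain := hind K le_rfl
  rw [hT0, hTK] at hmain
  change ∑ q ∈ midPrimes (z N) (y N), f q ≤ 2 * Real.log 6 + δ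
  have hmid : midPrimes (z N) (y N) =
      (Nat.primesBelow ⌈(N : ℝ) ^ (1 / 3 : ℝ)⌉₊).filter (fun q : ℕ => (N : ℝ) ^ (1 / 8 : ℝ) ≤ q) := rfl
  rw [hmid]
  refine hmain.trans ?_
  -- split the bound into the Riemann sum and the error sum
  have hsplit : ∑ i ∈ Finset.range K, Bd i =
      ∑ i ∈ Finset.range K, 1 / (1 / 2 - T (i + 1)) * Real.log (T (i + 1) / T i) +
        ∑ i ∈ Finset.range K, 1 / (1 / 2 - T (i + 1)) * (L₀ / (T i * Real.log N)) := by
    rw [← Finset.sum_add_distrib]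
    exact Finset.sum_congr rfl fun i _ => by simp only [hBd]; ring
  rw [hsplit]
  -- the Riemann sum: telescoping
  have hM : (1 + 8 * Δ) * (1 + 6 * Δ) ≤ 1 + 15 * Δ := by nlinarith
  have hlog6 : Real.log 6 < 2 := by
    have h := Real.exp_one_gt_d9
    have h6 : (6 : ℝ) < Real.exp 1 * Real.exp 1 := by nlinarith
    rw [← Real.exp_add, show (1 : ℝ) + 1 = 2 by norm_num] at h6
    exact (Real.log_lt_iff_lt_exp (by norm_num)).mpr h6
  have hlog6pos : 0 < Real.log 6 := Real.log_pos (by norm_num)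
  have hR : ∑ i ∈ Finset.range K, 1 / (1 / 2 - T (i + 1)) * Real.log (T (i + 1) / T i) ≤
      2 * Real.log 6 + δ / 2 := by
    set G : ℝ → ℝ := fun t => 2 * (Real.log t - Real.log (1 / 2 - t)) with hG
    have hterm : ∀ i ∈ Finset.range K, 1 / (1 / 2 - T (i + 1)) * Real.log (T (i + 1) / T i) ≤
        (1 + 8 * Δ) * (1 + 6 * Δ) * (G (T (i + 1)) - G (T i)) := by
      intro i hi
      rw [Finset.mem_range] at hi
      have h := riemannTerm_le (hTlo i) (by linarith [hTsucc i]) (hThi (i + 1) hi)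
      rw [hTsucc i] at h
      exact h
    calc ∑ i ∈ Finset.range K, 1 / (1 / 2 - T (i + 1)) * Real.log (T (i + 1) / T i)
        ≤ ∑ i ∈ Finset.range K, (1 + 8 * Δ) * (1 + 6 * Δ) * (G (T (i + 1)) - G (T i)) :=
          Finset.sum_le_sum hterm
      _ = (1 + 8 * Δ) * (1 + 6 * Δ) * (G (T K) - G (T 0)) := by
          have htel : ∑ i ∈ Finset.range K, (G (T (i + 1)) - G (T i)) = G (T K) - G (T 0) :=
            Finset.sum_range_sub (fun i => G (T i)) K
          rw [← Finset.mul_sum, htel]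
      _ = (1 + 8 * Δ) * (1 + 6 * Δ) * (2 * Real.log 6) := by
          rw [hTK, hT0, hG]
          simp only
          rw [riemannG_one_third_sub_one_eighth]
      _ ≤ (1 + 15 * Δ) * (2 * Real.log 6) := mul_le_mul_of_nonneg_right hM (by positivity)
      _ = 2 * Real.log 6 + 30 * Δ * Real.log 6 := by ring
      _ ≤ 2 * Real.log 6 + δ / 2 := by nlinarith
  -- the error sum
  have hE : ∑ i ∈ Finset.range K, 1 / (1 / 2 - T (i + 1)) * (L₀ / (T i * Real.log N)) ≤ δ / 2 := by
    have hterm : ∀ i ∈ Finset.range K, 1 / (1 / 2 - T (i + 1)) * (L₀ / (T i * Real.log N)) ≤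
        48 * L₀ / Real.log N := by
      intro i hi
      rw [Finset.mem_range] at hi
      have h1 : 1 / (1 / 2 - T (i + 1)) ≤ 6 := by
        rw [div_le_iff₀ (by linarith [hThi (i + 1) hi])]; linarith [hThi (i + 1) hi]
      have h2 : L₀ / (T i * Real.log N) ≤ 8 * L₀ / Real.log N := by
        rw [div_le_div_iff₀ (mul_pos (by linarith [hTlo i]) hlogNpos) hlogNpos]
        have h0 : 0 ≤ L₀ * Real.log N := mul_nonneg hL₀0 hlogNpos.le
        have h8 : 1 ≤ 8 * T i := by linarith [hTlo i]
        calc L₀ * Real.log N = 1 * (L₀ * Real.log N) := (one_mul _).symm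
          _ ≤ (8 * T i) * (L₀ * Real.log N) := mul_le_mul_of_nonneg_right h8 h0
          _ = 8 * L₀ * (T i * Real.log N) := by ring
      calc 1 / (1 / 2 - T (i + 1)) * (L₀ / (T i * Real.log N)) ≤ 6 * (8 * L₀ / Real.log N) :=
            mul_le_mul h1 h2 (by positivity) (by norm_num)
        _ = 48 * L₀ / Real.log N := by ring
    calc ∑ i ∈ Finset.range K, 1 / (1 / 2 - T (i + 1)) * (L₀ / (T i * Real.log N))
        ≤ ∑ i ∈ Finset.range K, 48 * L₀ / Real.log N := Finset.sum_le_sum hterm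
      _ = K * (48 * L₀ / Real.log N) := by rw [Finset.sum_const, Finset.card_range, nsmul_eq_mul]
      _ ≤ δ / 2 := by
          rw [mul_div_assoc', div_le_iff₀ hlogNpos]
          have hlogN' : 96 * K * L₀ ≤ δ * Real.log N := by
            have h := (div_le_iff₀ hδ).mp (show 96 * K * L₀ / δ ≤ Real.log N by linarith)
            linarith
          linarith
  linarith

/-! ### The linear sieve upper bound with `F(s) = 2e^γ/s` (Nathanson Thms 9.7–9.8, proved form) -/

/-- **Upper bound of the linear sieve, uniform in the sequence, with a nonnegative error constant**:
the tree's `LinearSieve.upper_explicit` (Iwaniec's Theorem 1 at `κ = 1`,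
`Iwaniec1980_thm1_upper_of_half_lt`, with `F_1(s) = 2e^γ/s` on `(0, 3]`, `upperSieveFun_one_eq_holds`;
Nathanson Thm 9.7 (9.35) with Thm 9.8), restated with `C ≥ 0` (replace `C` by `max(C, 0)`). For every
sifted sequence `𝒜` whose density has dimension `Ω(1, L)`, every `x` with `X(x) ≥ 0` and all
`2 ≤ z ≤ y` with `s = log y/log z ≤ 3`:
`S(𝒜, z; x) ≤ X(x) V(z) (2e^γ/s + C (log y)^{−1/3}) + ∑_{d < y, d ∣ P(z)} |R_d(x)|`.
[cite: Nathanson1996, Thm 9.7 (9.35) and Thm 9.8] [cite: IwaniecActaArith1980, Thm 1 (1.4)] -/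
theorem linearSieve_upper_le (L : ℝ) :
    ∃ C : ℝ, 0 ≤ C ∧ ∀ A : SieveSequence, HasIwaniecDimension A.density 1 L →
      ∀ x y z : ℝ, 2 ≤ z → z ≤ y → Real.log y / Real.log z ≤ 3 → 0 ≤ A.size x →
        A.sifted x (primesProdBelow z) ≤
          A.size x * A.densityProduct (primesProdBelow z) *
              (2 * Real.exp Real.eulerMascheroniConstant / (Real.log y / Real.log z) +
                C * Real.log y ^ (-(1 / 3 : ℝ))) +
            ∑ d ∈ (Finset.range ⌈y⌉₊).filter (· ∣ primesProdBelow z), |A.remainder d x| := by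
  obtain ⟨C, hC⟩ := LinearSieve.upper_explicit L
  refine ⟨max C 0, le_max_right _ _, fun A hA x y z hz hzy hs3 hX => ?_⟩
  have hlogy : 0 < Real.log y := Real.log_pos (by linarith)
  refine (hC A hA x y z hz hzy hs3 hX).trans ?_
  have hV : 0 ≤ A.densityProduct (primesProdBelow z) := (hA.densityProduct_pos z).le
  have hXV : 0 ≤ A.size x * A.densityProduct (primesProdBelow z) := mul_nonneg hX hV
  have hpow : 0 ≤ Real.log y ^ (-(1 / 3 : ℝ)) := Real.rpow_nonneg hlogy.le _
  have hCle : C * Real.log y ^ (-(1 / 3 : ℝ)) ≤ max C 0 * Real.log y ^ (-(1 / 3 : ℝ)) :=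
    mul_le_mul_of_nonneg_right (le_max_left _ _) hpow
  nlinarith [mul_le_mul_of_nonneg_left hCle hXV]

/-! ### The Goldbach sifted sequences `A_q` (Nathanson §10.2, §10.5)

`𝒜 = {N − p : p ≤ N, p ∈ 𝒫}`, `𝒫 = {p ∤ N}` ((10.6)), is encoded by the set of `n < N` with `N − n`
a prime not dividing `N`; `A_q` carries the weights `1_𝒜(n) 1_{q ∣ n}`, the density
`g_N(d) = 1/φ(d)` for `(d, N) = 1` (`0` otherwise: the primes dividing `N` are not sifting primes,
and `𝒜_p = ∅` for them) and the free size parameter `X_q = π(N)/(q − 1) = π(N) g(q)`, so that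
`R_d = |A_{qd}| − π(N)/φ(qd)` for `d ∣ P(z)` coprime to `N` (Nathanson's `r(qd)` up to the
`O(ω(N))` primes dividing `N`, p. 171) and `R_d = 0` otherwise. -/

/-- The set `𝒜 = {N − p : p ≤ N prime, p ∤ N}` of (10.6), as `{n < N : N − n prime, (N − n) ∤ N}`.
[cite: Nathanson1996, (10.6)] -/
def goldbachSet (N : ℕ) : Finset ℕ :=
  (Finset.range N).filter (fun n => (N - n).Prime ∧ ¬(N - n) ∣ N)

/-- Membership in `𝒜`. [folklore] -/
theorem mem_goldbachSet {N n : ℕ} :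
    n ∈ goldbachSet N ↔ n < N ∧ (N - n).Prime ∧ ¬(N - n) ∣ N := by
  simp [goldbachSet]

/-- Elements of `𝒜` are coprime to `N` (Nathanson p. 168: "`(n, N) = 1` for all `n ∈ 𝒜`").
[cite: Nathanson1996, §10.2 (p. 168)] -/
theorem coprime_of_mem_goldbachSet {N n : ℕ} (hn : n ∈ goldbachSet N) : n.Coprime N := by
  obtain ⟨hnN, hp, hndvd⟩ := mem_goldbachSet.mp hn
  have hg : Nat.gcd n N ∣ N - n := Nat.dvd_sub (Nat.gcd_dvd_right n N) (Nat.gcd_dvd_left n N)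
  rcases (Nat.dvd_prime hp).mp hg with h | h
  · exact h
  · exact absurd (h ▸ Nat.gcd_dvd_right n N) hndvd

/-- Elements of `𝒜` are positive. [folklore] -/
theorem pos_of_mem_goldbachSet {N n : ℕ} (hn : n ∈ goldbachSet N) : 0 < n := by
  obtain ⟨hnN, -, hndvd⟩ := mem_goldbachSet.mp hn
  by_contra h
  obtain rfl : n = 0 := by omega
  exact hndvd (by simp)

/-- A prime dividing `N` divides no element of `𝒜` (so `𝒜_p = ∅` for `p ∣ N`). [folklore] -/
theorem not_dvd_of_mem_goldbachSet {N n r : ℕ} (hn : n ∈ goldbachSet N) (hr : r.Prime)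
    (hrN : r ∣ N) : ¬r ∣ n := fun hrn =>
  (Nat.Prime.one_lt hr).ne'
    (Nat.Coprime.eq_one_of_dvd (Nat.Coprime.coprime_dvd_left hrn (coprime_of_mem_goldbachSet hn)) hrN)

/-- The weights of `A_q`: `a_q(n) = 1` if `n ∈ 𝒜` and `q ∣ n`, else `0` (Nathanson p. 168).
[cite: Nathanson1996, §10.2 (definition of a_q(n))] -/
def goldbachWeight (N q n : ℕ) : ℝ :=
  if n ∈ goldbachSet N ∧ q ∣ n then 1 else 0

/-- **The sifted sequence `A_q`** of Nathanson's Thm 10.5: weights `a_q(n)`, density `g_N`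
(`1/φ(d)` on `(d, N) = 1`), size `X_q = π(N)/(q − 1)`. [cite: Nathanson1996, §10.5] -/
def goldbachSeq (N q : ℕ) : SieveSequence where
  a := goldbachWeight N q
  a_nonneg n := by unfold goldbachWeight; split_ifs <;> norm_num
  size := fun _ => (Nat.primeCounting N : ℝ) / ((q : ℝ) - 1)
  density := shiftedPrimesDensity N
  density_mult := isMultiplicative_shiftedPrimesDensity N

/-- `S(A_q, 𝒫, z)` in the tree's vocabulary: sifting `A_q` by ALL primes `< w` counts exactly
Nathanson's `S(A_q, 𝒫, w)` = `siftedCountDvd N q w` (elements of `𝒜` are coprime to `N`, so the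
primes dividing `N` sift nothing). [cite: Nathanson1996, §10.2] -/
theorem sifted_goldbachSeq_eq (N q : ℕ) (w : ℝ) :
    (goldbachSeq N q).sifted N (primesProdBelow w) = siftedCountDvd N q w := by
  classical
  unfold SieveSequence.sifted siftedCountDvd
  simp only [goldbachSeq, goldbachWeight, Nat.floor_natCast, Finset.sum_boole]
  norm_cast
  refine Finset.card_nbij' (fun n => (N - n, n)) (fun a => a.2) ?_ ?_ (fun n _ => rfl) ?_
  · intro n hn
    simp only [Finset.mem_coe, Finset.mem_filter, Finset.mem_Ioc] at hn
    obtain ⟨⟨⟨hn0, hnN⟩, hcop⟩, hgs, hqn⟩ := hn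
    obtain ⟨hnlt, hp, hpN⟩ := mem_goldbachSet.mp hgs
    simp only [Finset.mem_coe, Finset.mem_filter, Finset.HasAntidiagonal.mem_antidiagonal]
    refine ⟨Nat.sub_add_cancel hnN, hp, hpN, hqn, fun r hr _ => ?_⟩
    exact (coprime_primesProdBelow_iff n w).mp hcop r hr
  · rintro ⟨p, n⟩ ha
    simp only [Finset.mem_coe, Finset.mem_filter, Finset.HasAntidiagonal.mem_antidiagonal] at ha
    obtain ⟨hpn, hp, hpN, hqn, hsift⟩ := ha
    have hnN : n ≤ N := by omega
    have hNn : N - n = p := by omega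
    have hgs : n ∈ goldbachSet N := by
      rw [mem_goldbachSet, hNn]
      refine ⟨lt_of_le_of_ne hnN ?_, hp, hpN⟩
      rintro rfl
      obtain rfl : p = 0 := by omega
      exact Nat.not_prime_zero hp
    simp only [Finset.mem_coe, Finset.mem_filter, Finset.mem_Ioc]
    refine ⟨⟨⟨pos_of_mem_goldbachSet hgs, hnN⟩, ?_⟩, hgs, hqn⟩
    refine (coprime_primesProdBelow_iff n w).mpr fun r hr => ?_
    by_cases hrN : r ∣ N
    · exact not_dvd_of_mem_goldbachSet hgs (Nat.prime_of_mem_primesBelow hr) hrN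
    · exact hsift r hr hrN
  · rintro ⟨p, n⟩ ha
    simp only [Finset.mem_coe, Finset.mem_filter, Finset.HasAntidiagonal.mem_antidiagonal] at ha
    ext
    · show N - n = p; omega
    · rfl

/-- The density of `A_q` at a prime: `g_N(p) = 1/(p − 1)` for `p ∤ N`, `0` for `p ∣ N`. [folklore] -/
theorem density_goldbachSeq_prime {N q p : ℕ} (hp : p.Prime) :
    (goldbachSeq N q).density p = if p ∣ N then 0 else 1 / ((p : ℝ) - 1) := by
  change shiftedPrimesDensity N p = _
  rw [shiftedPrimesDensity_apply]
  by_cases hpN : p ∣ N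
  · rw [if_pos hpN, if_neg]
    rintro ⟨hc, -⟩
    exact hp.one_lt.ne' (Nat.Coprime.eq_one_of_dvd hc hpN)
  · rw [if_neg hpN, if_pos ⟨(Nat.Prime.coprime_iff_not_dvd hp).mpr hpN, hp.ne_zero⟩,
      Nat.totient_prime hp, Nat.cast_sub hp.one_lt.le, Nat.cast_one, one_div]

/-- `V(z)` in the tree's vocabulary: `∏_{p < w} (1 − g_N(p)) = ∏_{p < w, p ∤ N} (1 − 1/(p−1))
= sieveProduct N w` ((10.8)). [cite: Nathanson1996, (10.8)] -/
theorem densityProduct_goldbachSeq_eq (N q : ℕ) (w : ℝ) :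
    (goldbachSeq N q).densityProduct (primesProdBelow w) = sieveProduct N w := by
  rw [SieveSequence.densityProduct, primeFactors_primesProdBelow, sieveProduct,
    ← Finset.prod_filter_mul_prod_filter_not (Nat.primesBelow ⌈w⌉₊) (fun p : ℕ => ¬p ∣ N)]
  have h1 : ∏ p ∈ (Nat.primesBelow ⌈w⌉₊).filter (fun p : ℕ => ¬¬p ∣ N),
      (1 - (goldbachSeq N q).density p) = 1 := by
    refine Finset.prod_eq_one fun p hp => ?_
    rw [Finset.mem_filter, not_not] at hp
    rw [density_goldbachSeq_prime (Nat.prime_of_mem_primesBelow hp.1), if_pos hp.2, sub_zero]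
  rw [h1, mul_one]
  refine Finset.prod_congr rfl fun p hp => ?_
  rw [Finset.mem_filter] at hp
  rw [density_goldbachSeq_prime (Nat.prime_of_mem_primesBelow hp.1), if_neg hp.2]

/-- `|(A_q)_d| = #{p ≤ N prime : p ∤ N, qd ∣ N − p}` for `(q, d) = 1` (Nathanson p. 172:
`|(A_q)_d| = |A_{qd}|`). [cite: Nathanson1996, Thm 10.5 (proof, p. 172)] -/
theorem congrSum_goldbachSeq_eq {N q d : ℕ} (hqd : q.Coprime d) :
    (goldbachSeq N q).congrSum d N =
      #{p ∈ Finset.range (N + 1) | p.Prime ∧ ¬p ∣ N ∧ q * d ∣ N - p} := by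
  classical
  unfold SieveSequence.congrSum
  simp only [goldbachSeq, goldbachWeight, Nat.floor_natCast, Finset.sum_boole]
  norm_cast
  refine Finset.card_nbij' (fun n => N - n) (fun p => N - p) ?_ ?_ ?_ ?_
  · intro n hn
    simp only [Finset.mem_coe, Finset.mem_filter, Finset.mem_Ioc] at hn
    obtain ⟨⟨⟨hn0, hnN⟩, hdn⟩, hgs, hqn⟩ := hn
    obtain ⟨hnlt, hp, hpN⟩ := mem_goldbachSet.mp hgs
    simp only [Finset.mem_coe, Finset.mem_filter, Finset.mem_range]
    refine ⟨by omega, hp, hpN, ?_⟩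
    rw [Nat.sub_sub_self hnN]
    exact hqd.mul_dvd_of_dvd_of_dvd hqn hdn
  · intro p hp
    simp only [Finset.mem_coe, Finset.mem_filter, Finset.mem_range] at hp
    obtain ⟨hple, hpp, hpN, hqdp⟩ := hp
    have hpN' : p ≤ N := by omega
    have hplt : p < N := lt_of_le_of_ne hpN' (by rintro rfl; exact hpN dvd_rfl)
    have hgs : N - p ∈ goldbachSet N := by
      rw [mem_goldbachSet, Nat.sub_sub_self hpN']
      exact ⟨Nat.sub_lt (by omega) hpp.pos, hpp, hpN⟩
    simp only [Finset.mem_coe, Finset.mem_filter, Finset.mem_Ioc]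
    exact ⟨⟨⟨Nat.sub_pos_of_lt hplt, Nat.sub_le N p⟩, (dvd_mul_left d q).trans hqdp⟩, hgs,
      (dvd_mul_right q d).trans hqdp⟩
  · intro n hn
    simp only [Finset.mem_coe, Finset.mem_filter, Finset.mem_Ioc] at hn
    exact Nat.sub_sub_self hn.1.1.2
  · intro p hp
    simp only [Finset.mem_coe, Finset.mem_filter, Finset.mem_range] at hp
    exact Nat.sub_sub_self (by omega)

/-- `π(N; m, N) = #{p ≤ N prime : m ∣ N − p}` in the tree's `primeCountingMod`. [folklore] -/
theorem primeCountingMod_natCast_eq {N m : ℕ} :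
    LevelOfDistribution.primeCountingMod m ((N : ZMod m)).val N =
      #{p ∈ Finset.range (N + 1) | p.Prime ∧ m ∣ N - p} := by
  unfold LevelOfDistribution.primeCountingMod
  congr 1
  refine Finset.filter_congr fun p hp => ?_
  rw [Finset.mem_range] at hp
  have hiff : p ≡ (N : ZMod m).val [MOD m] ↔ m ∣ N - p := by
    rw [ZMod.val_natCast]
    have : p ≡ N % m [MOD m] ↔ p ≡ N [MOD m] := by
      constructor
      · intro h; exact h.trans (Nat.mod_modEq N m)
      · intro h; exact h.trans (Nat.mod_modEq N m).symm
    rw [this, Nat.modEq_iff_dvd' (by omega)]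
  rw [hiff]

/-- **The remainder of `A_q` is Nathanson's `r(qd)` up to `ω(N)`**: for `q` prime, `q ∤ N`,
`d ≠ 0` coprime to `N` and to `q`,
`|R_d| = ||A_{qd}| − π(N)/φ(qd)| ≤ |π(N; qd, N) − π(N)/φ(qd)| + ω(N)`
(Nathanson p. 171: `|A_d| = π(N; d, N) + O(ω(N))`, and p. 173). [cite: Nathanson1996, (10.9) and p. 171] -/
theorem abs_remainder_goldbachSeq_le {N q d : ℕ} (hq : q.Prime) (hqN : ¬q ∣ N)
    (hd : d.Coprime N) (hd0 : d ≠ 0) (hqd : q.Coprime d) :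
    |(goldbachSeq N q).remainder d N| ≤
      |primeCountingDisc (q * d) (N : ZMod (q * d)) N| + (N.primeFactors.card : ℝ) := by
  classical
  have hm0 : q * d ≠ 0 := mul_ne_zero hq.ne_zero hd0
  -- the main term
  have hdens : (goldbachSeq N q).density d = ((Nat.totient d : ℕ) : ℝ)⁻¹ := by
    change shiftedPrimesDensity N d = _
    rw [shiftedPrimesDensity_apply, if_pos ⟨hd, hd0⟩]
  have hφ : ((Nat.totient (q * d) : ℕ) : ℝ) = ((q : ℝ) - 1) * (Nat.totient d : ℕ) := by
    rw [Nat.totient_mul hqd, Nat.totient_prime hq, Nat.cast_mul, Nat.cast_sub hq.one_lt.le,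
      Nat.cast_one]
  have hq1 : (0 : ℝ) < (q : ℝ) - 1 := by
    have : (2 : ℝ) ≤ q := by exact_mod_cast hq.two_le
    linarith
  have hφd : (0 : ℝ) < (Nat.totient d : ℕ) := by exact_mod_cast Nat.totient_pos.mpr (Nat.pos_of_ne_zero hd0)
  have hmain : (goldbachSeq N q).density d * (goldbachSeq N q).size N =
      (Nat.primeCounting N : ℝ) / (Nat.totient (q * d) : ℕ) := by
    rw [hdens, hφ]
    change ((Nat.totient d : ℕ) : ℝ)⁻¹ * ((Nat.primeCounting N : ℝ) / ((q : ℝ) - 1)) = _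
    field_simp
  -- the count, split by `p ∣ N`
  set full := #{p ∈ Finset.range (N + 1) | p.Prime ∧ q * d ∣ N - p} with hfull
  set bad := #{p ∈ Finset.range (N + 1) | p.Prime ∧ p ∣ N ∧ q * d ∣ N - p} with hbad
  have hcount : ((goldbachSeq N q).congrSum d N : ℝ) = (full : ℝ) - bad := by
    rw [congrSum_goldbachSeq_eq hqd, eq_sub_iff_add_eq]
    norm_cast
    rw [hfull, hbad, ← Finset.card_union_of_disjoint]
    · congr 1
      ext p
      simp only [Finset.mem_union, Finset.mem_filter]
      tauto
    · exact Finset.disjoint_left.mpr fun p h1 h2 =>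
        (Finset.mem_filter.mp h1).2.2.1 (Finset.mem_filter.mp h2).2.2.1
  have hbadle : bad ≤ N.primeFactors.card := by
    rw [hbad]
    by_cases hN : N = 0
    · subst hN
      have : Finset.filter (fun p => p.Prime ∧ p ∣ 0 ∧ q * d ∣ 0 - p) (Finset.range (0 + 1)) = ∅ := by
        ext p; simp; rintro rfl; exact Nat.not_prime_zero
      rw [this]; simp
    refine Finset.card_le_card fun p hp => ?_
    rw [Finset.mem_filter] at hp
    exact Nat.mem_primeFactors.mpr ⟨hp.2.1, hp.2.2.1, hN⟩
  have hdisc : (full : ℝ) - (Nat.primeCounting N : ℝ) / (Nat.totient (q * d) : ℕ) =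
      primeCountingDisc (q * d) (N : ZMod (q * d)) N := by
    rw [← primeCountingMod_sub_div_eq hm0, primeCountingMod_natCast_eq]
  rw [SieveSequence.remainder, hmain, hcount,
    show (full : ℝ) - bad - (Nat.primeCounting N : ℝ) / (Nat.totient (q * d) : ℕ) =
      primeCountingDisc (q * d) (N : ZMod (q * d)) N - bad by rw [← hdisc]; ring]
  have hbad' : (bad : ℝ) ≤ N.primeFactors.card := by exact_mod_cast hbadle
  have hbad0 : (0 : ℝ) ≤ bad := Nat.cast_nonneg _
  calc |primeCountingDisc (q * d) (N : ZMod (q * d)) N - bad|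
      ≤ |primeCountingDisc (q * d) (N : ZMod (q * d)) N| + |(bad : ℝ)| := abs_sub _ _
    _ ≤ _ := by rw [abs_of_nonneg hbad0]; linarith

/-- For `d` not coprime to `N` the remainder of `A_q` vanishes: `g_N(d) = 0` and no element of `𝒜`
is divisible by `d`. [folklore] -/
theorem remainder_goldbachSeq_eq_zero {N q d : ℕ} (hd : ¬d.Coprime N) :
    (goldbachSeq N q).remainder d N = 0 := by
  have hdens : (goldbachSeq N q).density d = 0 := by
    change shiftedPrimesDensity N d = 0
    rw [shiftedPrimesDensity_apply, if_neg (fun h => hd h.1)]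
  have hcongr : (goldbachSeq N q).congrSum d N = 0 := by
    unfold SieveSequence.congrSum
    refine Finset.sum_eq_zero fun n hn => ?_
    simp only [goldbachSeq, goldbachWeight]
    rw [if_neg]
    rintro ⟨hgs, -⟩
    exact hd (Nat.Coprime.coprime_dvd_left (Finset.mem_filter.mp hn).2 (coprime_of_mem_goldbachSet hgs))
  rw [SieveSequence.remainder, hdens, hcongr, zero_mul, sub_zero]

/-- If `q ∣ N` then `S(A_q, 𝒫, z) = 0` (Nathanson p. 172: "`|A_q| = 0` if `q` divides `N`").
[cite: Nathanson1996, Thm 10.5 (proof, p. 172)] -/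
theorem siftedCountDvd_eq_zero_of_dvd {N q : ℕ} (hq : q.Prime) (hqN : q ∣ N) (w : ℝ) :
    siftedCountDvd N q w = 0 := by
  classical
  unfold siftedCountDvd
  refine Finset.card_eq_zero.mpr (Finset.filter_eq_empty_iff.mpr ?_)
  rintro ⟨p, n⟩ ha ⟨hp, hpN, hqn, -⟩
  rw [Finset.HasAntidiagonal.mem_antidiagonal] at ha
  have hqp : q ∣ p := by
    have : q ∣ p + n := ha ▸ hqN
    exact (Nat.dvd_add_right hqn).mp (by rwa [add_comm] at this)
  rcases (Nat.dvd_prime hp).mp hqp with h | h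
  · exact hq.one_lt.ne' h
  · exact hpN (h ▸ hqN)

/-! ### The remainder: reduction to Bombieri–Vinogradov (Nathanson p. 173) -/

/-- For `q ≥ z` prime and `d ∣ P(z)`: `q ∤ d`, so `(q, d) = 1`. [folklore] -/
theorem coprime_of_dvd_primesProdBelow {q d : ℕ} {w : ℝ} (hq : q.Prime) (hwq : w ≤ (q : ℝ))
    (hd : d ∣ primesProdBelow w) : q.Coprime d := by
  rw [Nat.Prime.coprime_iff_not_dvd hq]
  intro hqd
  have := (dvd_primesProdBelow_iff hq w).mp (hqd.trans hd)
  linarith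

/-- **The remainder of one `A_q`** (Nathanson p. 173, `R_q ≤ ∑_{d<D_q, d∣P(z)} |r(qd)| + …`): for
`q ≥ z` prime with `q ∤ N`,
`∑_{d < Y, d ∣ P(z)} |R_d| ≤ ∑_{d < Y, d ∣ P(z), (d,N)=1} (|π(N; qd, N) − π(N)/φ(qd)| + ω(N))`.
[cite: Nathanson1996, Thm 10.5 (proof, p. 173)] -/
theorem remainderSum_goldbachSeq_le {N q : ℕ} {w Y : ℝ} (hq : q.Prime) (hqN : ¬q ∣ N)
    (hwq : w ≤ (q : ℝ)) :
    ∑ d ∈ (Finset.range ⌈Y⌉₊).filter (· ∣ primesProdBelow w), |(goldbachSeq N q).remainder d N| ≤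
      ∑ d ∈ ((Finset.range ⌈Y⌉₊).filter (· ∣ primesProdBelow w)).filter (fun d => d.Coprime N),
        (|primeCountingDisc (q * d) (N : ZMod (q * d)) N| + (N.primeFactors.card : ℝ)) := by
  rw [← Finset.sum_filter_add_sum_filter_not ((Finset.range ⌈Y⌉₊).filter (· ∣ primesProdBelow w))
    (fun d => d.Coprime N)]
  have hzero : ∑ d ∈ ((Finset.range ⌈Y⌉₊).filter (· ∣ primesProdBelow w)).filter
      (fun d => ¬d.Coprime N), |(goldbachSeq N q).remainder d N| = 0 :=
    Finset.sum_eq_zero fun d hd => by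
      rw [remainder_goldbachSeq_eq_zero (Finset.mem_filter.mp hd).2, abs_zero]
  rw [hzero, add_zero]
  refine Finset.sum_le_sum fun d hd => ?_
  rw [Finset.mem_filter, Finset.mem_filter] at hd
  obtain ⟨⟨-, hdP⟩, hdN⟩ := hd
  have hd0 : d ≠ 0 := fun h => primesProdBelow_ne_zero w (zero_dvd_iff.mp (h ▸ hdP))
  exact abs_remainder_goldbachSeq_le hq hqN hdN hd0 (coprime_of_dvd_primesProdBelow hq hwq hdP)

/-- **Summing the remainders over `q`: the moduli `qd` are distinct** (Nathanson p. 173: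
`R' ≤ ∑_{d' < QD, (d',N)=1} |r(d')| + …`). For the primes `q ≥ z` not dividing `N` and
`d ∣ P(z)` coprime to `N` with `d < D/q`, the map `(q, d) ↦ qd` is injective into the moduli
`m ≤ D` coprime to `N`; hence for every `u` choosing the residue `N mod m` whenever `(m, N) = 1`,
`∑_q ∑_d (|π(N; qd, N) − π(N)/φ(qd)| + ω(N)) ≤ ∑_{m ≤ D} |π(N; m, u_m) − π(N)/φ(m)| + D ω(N)`.
[cite: Nathanson1996, Thm 10.5 (proof, p. 173)] -/
theorem sum_remainderSum_le {N : ℕ} {w D : ℝ} (hD : 0 ≤ D) (Q : Finset ℕ)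
    (hQ : ∀ q ∈ Q, q.Prime ∧ ¬q ∣ N ∧ w ≤ (q : ℝ))
    (u : (m : ℕ) → (ZMod m)ˣ) (hu : ∀ m : ℕ, (h : N.Coprime m) → u m = ZMod.unitOfCoprime N h) :
    ∑ q ∈ Q, ∑ d ∈ ((Finset.range ⌈D / q⌉₊).filter (· ∣ primesProdBelow w)).filter
        (fun d => d.Coprime N),
        (|primeCountingDisc (q * d) (N : ZMod (q * d)) N| + (N.primeFactors.card : ℝ)) ≤
      ∑ m ∈ Finset.Icc 1 ⌊D⌋₊, |primeCountingDisc m (u m) N| + D * N.primeFactors.card := by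
  classical
  set T : ℕ → Finset ℕ := fun q =>
    ((Finset.range ⌈D / q⌉₊).filter (· ∣ primesProdBelow w)).filter (fun d => d.Coprime N) with hT
  set g : ℕ → ℝ := fun m => |primeCountingDisc m (u m : ZMod m) N| + (N.primeFactors.card : ℝ)
    with hg
  have hg0 : ∀ m, 0 ≤ g m := fun m => by simp only [hg]; positivity
  -- membership facts
  have hmemT : ∀ q ∈ Q, ∀ d ∈ T q, d ∣ primesProdBelow w ∧ d.Coprime N ∧ d ≠ 0 ∧
      (q * d : ℝ) < D ∧ (q * d).Coprime N ∧ q.Coprime d := by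
    intro q hq d hd
    obtain ⟨hqp, hqN, hwq⟩ := hQ q hq
    simp only [hT, Finset.mem_filter, Finset.mem_range, Nat.lt_ceil] at hd
    obtain ⟨⟨hdlt, hdP⟩, hdN⟩ := hd
    have hd0 : d ≠ 0 := fun h => primesProdBelow_ne_zero w (zero_dvd_iff.mp (h ▸ hdP))
    have hq0 : (0 : ℝ) < q := by exact_mod_cast hqp.pos
    have hqd : (q * d : ℝ) < D := by
      rw [lt_div_iff₀ hq0] at hdlt; linarith
    refine ⟨hdP, hdN, hd0, hqd, ?_, coprime_of_dvd_primesProdBelow hqp hwq hdP⟩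
    exact Nat.Coprime.mul_left ((Nat.Prime.coprime_iff_not_dvd hqp).mpr hqN) hdN
  -- the summand is `g (q d)`
  have hsummand : ∀ q ∈ Q, ∀ d ∈ T q,
      |primeCountingDisc (q * d) (N : ZMod (q * d)) N| + (N.primeFactors.card : ℝ) = g (q * d) := by
    intro q hq d hd
    obtain ⟨-, -, -, -, hcop, -⟩ := hmemT q hq d hd
    simp only [hg, hu (q * d) hcop.symm, ZMod.coe_unitOfCoprime]
  rw [Finset.sum_congr rfl fun q hq => Finset.sum_congr rfl fun d hd => hsummand q hq d hd,
    Finset.sum_sigma']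
  -- injectivity of `(q, d) ↦ q d`
  set f : (Σ _ : ℕ, ℕ) → ℕ := fun x => x.1 * x.2 with hf
  have hinj : Set.InjOn f ↑(Q.sigma T) := by
    rintro ⟨q, d⟩ hx ⟨q', d'⟩ hy hxy
    simp only [Finset.mem_coe, Finset.mem_sigma] at hx hy
    simp only [hf] at hxy
    obtain ⟨hqp, -, hwq⟩ := hQ q hx.1
    obtain ⟨hqp', -, hwq'⟩ := hQ q' hy.1
    obtain ⟨-, -, -, -, -, hcop'⟩ := hmemT q' hy.1 d' hy.2
    obtain ⟨-, -, hd0, -, -, -⟩ := hmemT q hx.1 d hx.2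
    have hqq' : q = q' := by
      have h1 : q ∣ q' * d' := ⟨d, by rw [hxy]⟩
      rcases (Nat.Prime.dvd_mul hqp).mp h1 with h | h
      · exact (Nat.prime_dvd_prime_iff_eq hqp hqp').mp h
      · exfalso
        have := (dvd_primesProdBelow_iff hqp w).mp (h.trans (hmemT q' hy.1 d' hy.2).1)
        linarith
    subst hqq'
    have hdd' : d = d' := Nat.eq_of_mul_eq_mul_left hqp.pos hxy
    subst hdd'
    rfl
  have himage : (Q.sigma T).image f ⊆ Finset.Icc 1 ⌊D⌋₊ := by
    intro m hm
    rw [Finset.mem_image] at hm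
    obtain ⟨⟨q, d⟩, hx, rfl⟩ := hm
    rw [Finset.mem_sigma] at hx
    obtain ⟨hqp, -, -⟩ := hQ q hx.1
    obtain ⟨-, -, hd0, hlt, -, -⟩ := hmemT q hx.1 d hx.2
    rw [Finset.mem_Icc]
    refine ⟨Nat.one_le_iff_ne_zero.mpr (mul_ne_zero hqp.ne_zero hd0), Nat.le_floor ?_⟩
    simp only [hf]; push_cast; exact hlt.le
  have hcard : ((Q.sigma T).card : ℝ) ≤ D := by
    have h1 : (Q.sigma T).card = ((Q.sigma T).image f).card := (Finset.card_image_of_injOn hinj).symm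
    have h2 : ((Q.sigma T).image f).card ≤ (Finset.Icc 1 ⌊D⌋₊).card := Finset.card_le_card himage
    rw [Nat.card_Icc, Nat.add_sub_cancel] at h2
    calc ((Q.sigma T).card : ℝ) ≤ ⌊D⌋₊ := by exact_mod_cast h1 ▸ h2
      _ ≤ D := Nat.floor_le hD
  calc ∑ x ∈ Q.sigma T, g (x.1 * x.2) = ∑ m ∈ (Q.sigma T).image f, g m := by
        rw [Finset.sum_image hinj]
    _ ≤ ∑ m ∈ Finset.Icc 1 ⌊D⌋₊, g m :=
        Finset.sum_le_sum_of_subset_of_nonneg himage fun m _ _ => hg0 m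
    _ = ∑ m ∈ Finset.Icc 1 ⌊D⌋₊, |primeCountingDisc m (u m) N| +
          (Finset.Icc 1 ⌊D⌋₊).card * (N.primeFactors.card : ℝ) := by
        rw [Finset.sum_add_distrib, Finset.sum_const, nsmul_eq_mul]
    _ ≤ _ := by
        rw [Nat.card_Icc, Nat.add_sub_cancel]
        have : ((⌊D⌋₊ : ℕ) : ℝ) ≤ D := Nat.floor_le hD
        have h0 : (0 : ℝ) ≤ N.primeFactors.card := Nat.cast_nonneg _
        nlinarith

/-- `ω(N) ≤ log₂ N ≤ 2 log N` for `N ≥ 1` (`2^{ω(N)} ≤ ∏_{p ∣ N} p ≤ N`). [folklore] -/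
theorem card_primeFactors_le_two_mul_log {N : ℕ} (hN : N ≠ 0) :
    (N.primeFactors.card : ℝ) ≤ 2 * Real.log N := by
  have h1 : 2 ^ N.primeFactors.card ≤ N := by
    calc 2 ^ N.primeFactors.card = ∏ _p ∈ N.primeFactors, 2 := by simp
      _ ≤ ∏ p ∈ N.primeFactors, p := Finset.prod_le_prod' fun p hp => (Nat.prime_of_mem_primeFactors hp).two_le
      _ ≤ N := Nat.le_of_dvd (Nat.pos_of_ne_zero hN) (Nat.prod_primeFactors_dvd N)
  have h2 : (N.primeFactors.card : ℝ) * Real.log 2 ≤ Real.log N := by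
    rw [← Real.log_pow]
    exact Real.log_le_log (by positivity) (by exact_mod_cast h1)
  have hlog2 := Real.log_two_gt_d9
  nlinarith [Real.log_nonneg (show (1 : ℝ) ≤ N by exact_mod_cast Nat.one_le_iff_ne_zero.mpr hN)]

/-! ### The sieve bound for one `A_q` (Nathanson p. 173: Thm 9.7 with `D_q = D/q`, `s_q ∈ [1, 3]`) -/

/-- `1/(1/2 − η − τ) ≤ (1/(1 − 6η)) · 1/(1/2 − τ)` for `τ ≤ 1/3`, `0 ≤ η < 1/6` (the level
`N^{1/2−η}` instead of `N^{1/2}(log N)^{−B}` costs a factor `1 + O(η)` in `F(s_q)`). [folklore] -/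
theorem one_div_sub_sub_le {η τ : ℝ} (hη0 : 0 ≤ η) (hη : η < 1 / 6) (hτ : τ ≤ 1 / 3) :
    1 / (1 / 2 - η - τ) ≤ 1 / (1 - 6 * η) * (1 / (1 / 2 - τ)) := by
  have h1 : 0 < 1 / 2 - η - τ := by linarith
  have h2 : 0 < 1 - 6 * η := by linarith
  have h3 : 0 < 1 / 2 - τ := by linarith
  rw [one_div_mul_one_div, div_le_div_iff₀ h1 (mul_pos h2 h3)]
  nlinarith

/-- **Thm 9.7–9.8 applied to `A_q`** (Nathanson p. 173): for even `N ≥ 3⁸`, `0 ≤ κ ≤ 1/24`, a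
prime `N^{1/8} ≤ q < N^{1/3}` and the level `D_q = N^{1/2−κ}/q` (so `z ≤ D_q`, `s_q ≤ 3 − 8κ`),
`S(A_q, 𝒫, z) ≤ π(N) V(z) g(q) ((e^γ/4)(1 − 6κ)⁻¹/(1/2 − log q/log N) + C ((1/6 − κ) log N)^{−1/3})
 + ∑_{d < D_q, d ∣ P(z)} |R_d|`, where `F(s_q) = 2e^γ/s_q = (e^γ/4)/(1/2 − κ − log q/log N)`.
[cite: Nathanson1996, Thm 10.5 (proof, p. 173, (10.10)–(10.11))] -/
theorem siftedCountDvd_le_of_sieve {N q : ℕ} {κ C : ℝ} (hN : Even N) (hN3 : 6561 ≤ N)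
    (hκ0 : 0 ≤ κ) (hκ1 : κ ≤ 1 / 24) (hC0 : 0 ≤ C)
    (hC : ∀ A : SieveSequence, HasIwaniecDimension A.density 1 (54 * Real.exp (54 / Real.log 2)) →
      ∀ x y z : ℝ, 2 ≤ z → z ≤ y → Real.log y / Real.log z ≤ 3 → 0 ≤ A.size x →
        A.sifted x (primesProdBelow z) ≤
          A.size x * A.densityProduct (primesProdBelow z) *
              (2 * Real.exp Real.eulerMascheroniConstant / (Real.log y / Real.log z) +
                C * Real.log y ^ (-(1 / 3 : ℝ))) +
            ∑ d ∈ (Finset.range ⌈y⌉₊).filter (· ∣ primesProdBelow z), |A.remainder d x|)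
    (hq : q ∈ midPrimes (z N) (y N)) :
    (siftedCountDvd N q (z N) : ℝ) ≤
      (Nat.primeCounting N : ℝ) * sieveProduct N (z N) * shiftedPrimesDensity 2 q *
          (Real.exp Real.eulerMascheroniConstant / 4 * (1 / (1 - 6 * κ)) *
              (1 / (1 / 2 - Real.log q / Real.log N)) +
            C * ((1 / 6 - κ) * Real.log N) ^ (-(1 / 3 : ℝ))) +
        ∑ d ∈ (Finset.range ⌈(N : ℝ) ^ (1 / 2 - κ : ℝ) / q⌉₊).filter (· ∣ primesProdBelow (z N)),
          |(goldbachSeq N q).remainder d N| := by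
  -- the prime `q` and the parameters
  obtain ⟨hqmem, hzq⟩ := Finset.mem_filter.mp hq
  rw [Nat.mem_primesBelow, Nat.lt_ceil] at hqmem
  obtain ⟨hqy, hqp⟩ := hqmem
  have hN' : (6561 : ℝ) ≤ N := by exact_mod_cast hN3
  have hN0 : (0 : ℝ) < N := by linarith
  have hN1 : (1 : ℝ) ≤ N := by linarith
  have hlogN : 0 < Real.log N := Real.log_pos (by linarith)
  have hz3 : (3 : ℝ) ≤ z N := by
    rw [z, show (6561 : ℝ) = 3 ^ (8 : ℝ) by norm_num] at *
    calc (3 : ℝ) = ((3 : ℝ) ^ (8 : ℝ)) ^ (1 / 8 : ℝ) := by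
          rw [← Real.rpow_mul (by norm_num)]; norm_num
      _ ≤ (N : ℝ) ^ (1 / 8 : ℝ) := Real.rpow_le_rpow (by positivity) hN' (by norm_num)
  have hz2 : (2 : ℝ) ≤ z N := by linarith
  have hq3 : (3 : ℝ) ≤ q := hz3.trans hzq
  have hq0 : (0 : ℝ) < q := by linarith
  have hq2 : q ≠ 2 := by rintro rfl; norm_num at hq3
  have hlogz : Real.log (z N) = Real.log N / 8 := by rw [z, Real.log_rpow hN0]; ring
  have hlogy : Real.log (y N) = Real.log N / 3 := by rw [y, Real.log_rpow hN0]; ring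
  have hlogz0 : 0 < Real.log (z N) := by rw [hlogz]; positivity
  set τ := Real.log q / Real.log N with hτ
  have hlogq : Real.log q = τ * Real.log N := by rw [hτ, div_mul_cancel₀ _ hlogN.ne']
  have hτlo : 1 / 8 ≤ τ := by
    rw [hτ, le_div_iff₀ hlogN]
    have := Real.log_le_log (by linarith) hzq
    rw [hlogz] at this; linarith
  have hτhi : τ < 1 / 3 := by
    rw [hτ, div_lt_iff₀ hlogN]
    have := Real.log_lt_log hq0 hqy
    rw [hlogy] at this; linarith
  set a : ℝ := 1 / 2 - κ with ha
  set Y : ℝ := (N : ℝ) ^ a / q with hY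
  have hY0 : 0 < Y := div_pos (Real.rpow_pos_of_pos hN0 a) hq0
  have hlogY : Real.log Y = (a - τ) * Real.log N := by
    rw [hY, Real.log_div (Real.rpow_pos_of_pos hN0 a).ne' hq0.ne', Real.log_rpow hN0, hlogq]; ring
  have haτ : 1 / 6 - κ ≤ a - τ := by rw [ha]; linarith
  have haτ0 : 0 < a - τ := by linarith
  have hlogY0 : 0 < Real.log Y := by rw [hlogY]; positivity
  -- `z ≤ Y` and `s ≤ 3`
  have hzY : z N ≤ Y := by
    have h1 : Real.log (z N) ≤ Real.log Y := by
      rw [hlogz, hlogY]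
      have : 1 / 8 ≤ a - τ := by linarith
      nlinarith
    exact (Real.log_le_log_iff (by linarith) hY0).mp h1
  have hs : Real.log Y / Real.log (z N) = 8 * (a - τ) := by
    rw [hlogY, hlogz]; field_simp
  have hs3 : Real.log Y / Real.log (z N) ≤ 3 := by rw [hs, ha]; linarith
  -- the sieve bound
  have hdim : HasIwaniecDimension (goldbachSeq N q).density 1 (54 * Real.exp (54 / Real.log 2)) :=
    hasIwaniecDimension_shiftedPrimesDensity hN
  have hsize : 0 ≤ (goldbachSeq N q).size N := by
    change 0 ≤ (Nat.primeCounting N : ℝ) / ((q : ℝ) - 1)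
    exact div_nonneg (Nat.cast_nonneg _) (by linarith)
  have hmain := hC (goldbachSeq N q) hdim N Y (z N) hz2 hzY hs3 hsize
  rw [sifted_goldbachSeq_eq, densityProduct_goldbachSeq_eq] at hmain
  refine hmain.trans (add_le_add ?_ le_rfl)
  -- identify and bound the main term
  have hg : shiftedPrimesDensity 2 q = 1 / ((q : ℝ) - 1) := shiftedPrimesDensity_two_prime hqp hq2
  have hX : (goldbachSeq N q).size N = (Nat.primeCounting N : ℝ) * shiftedPrimesDensity 2 q := by
    rw [hg]; change (Nat.primeCounting N : ℝ) / ((q : ℝ) - 1) = _; ring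
  rw [hX, hs]
  have hV0 : 0 ≤ sieveProduct N (z N) := by
    rw [← densityProduct_goldbachSeq_eq N q]; exact (hdim.densityProduct_pos _).le
  have hg0 : 0 ≤ shiftedPrimesDensity 2 q := (shiftedPrimesDensity_two_prime_mem_Ico hqp).1
  have hπ0 : (0 : ℝ) ≤ Nat.primeCounting N := Nat.cast_nonneg _
  -- `F(s_q)`
  have hF : 2 * Real.exp Real.eulerMascheroniConstant / (8 * (a - τ)) ≤
      Real.exp Real.eulerMascheroniConstant / 4 * (1 / (1 - 6 * κ)) * (1 / (1 / 2 - τ)) := by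
    have h1 : 1 / (a - τ) ≤ 1 / (1 - 6 * κ) * (1 / (1 / 2 - τ)) := by
      rw [ha, show (1 : ℝ) / 2 - κ - τ = 1 / 2 - κ - τ by ring]
      exact one_div_sub_sub_le hκ0 (by linarith) hτhi.le
    have e : 2 * Real.exp Real.eulerMascheroniConstant / (8 * (a - τ)) =
        Real.exp Real.eulerMascheroniConstant / 4 * (1 / (a - τ)) := by
      field_simp; ring
    rw [e, mul_assoc]
    exact mul_le_mul_of_nonneg_left h1 (by positivity)
  -- the error term
  have hE : C * Real.log Y ^ (-(1 / 3 : ℝ)) ≤ C * ((1 / 6 - κ) * Real.log N) ^ (-(1 / 3 : ℝ)) := by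
    refine mul_le_mul_of_nonneg_left ?_ hC0
    have hpos : 0 < (1 / 6 - κ) * Real.log N := mul_pos (by linarith) hlogN
    refine Real.rpow_le_rpow_of_nonpos hpos ?_ (by norm_num)
    rw [hlogY]; nlinarith
  have hcoef := add_le_add hF hE
  calc (Nat.primeCounting N : ℝ) * shiftedPrimesDensity 2 q * sieveProduct N (z N) *
        (2 * Real.exp Real.eulerMascheroniConstant / (8 * (a - τ)) + C * Real.log Y ^ (-(1 / 3 : ℝ)))
      ≤ (Nat.primeCounting N : ℝ) * shiftedPrimesDensity 2 q * sieveProduct N (z N) *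
        (Real.exp Real.eulerMascheroniConstant / 4 * (1 / (1 - 6 * κ)) * (1 / (1 / 2 - τ)) +
          C * ((1 / 6 - κ) * Real.log N) ^ (-(1 / 3 : ℝ))) :=
        mul_le_mul_of_nonneg_left hcoef (by positivity)
    _ = _ := by ring

/-! ### Assembly (Nathanson pp. 173–175) -/

/-- `z = N^{1/8} ≥ 3` for `N ≥ 3⁸ = 6561`. [folklore] -/
theorem three_le_z {N : ℕ} (hN3 : 6561 ≤ N) : (3 : ℝ) ≤ z N := by
  have hN' : (3 : ℝ) ^ (8 : ℝ) ≤ N := by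
    rw [show (3 : ℝ) ^ (8 : ℝ) = 6561 by norm_num]; exact_mod_cast hN3
  calc (3 : ℝ) = ((3 : ℝ) ^ (8 : ℝ)) ^ (1 / 8 : ℝ) := by
        rw [← Real.rpow_mul (by norm_num)]; norm_num
    _ ≤ (N : ℝ) ^ (1 / 8 : ℝ) := Real.rpow_le_rpow (by positivity) hN' (by norm_num)

/-- `e^γ ≤ 2` (`γ < 2/3` and `e² < 8`). [folklore] -/
theorem exp_eulerMascheroni_le_two : Real.exp Real.eulerMascheroniConstant ≤ 2 := by
  have h1 : Real.exp Real.eulerMascheroniConstant ≤ Real.exp (2 / 3) :=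
    Real.exp_le_exp.mpr Real.eulerMascheroniConstant_lt_two_thirds.le
  have he := Real.exp_one_lt_d9
  have he0 := Real.exp_pos (1 : ℝ)
  have h4 : Real.exp 2 ≤ 8 := by
    rw [show (2 : ℝ) = 1 + 1 by norm_num, Real.exp_add]; nlinarith
  have h3 : Real.exp (2 / 3 : ℝ) ^ 3 = Real.exp 2 := by rw [← Real.exp_nat_mul]; norm_num
  have h2 : Real.exp (2 / 3 : ℝ) ≤ 2 := by
    by_contra h5
    rw [not_le] at h5
    have h6 : (2 : ℝ) ^ 3 < Real.exp (2 / 3 : ℝ) ^ 3 := by gcongr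
    rw [h3] at h6; linarith
  linarith

/-- `log 6 < 2` (`6 < e²`). [folklore] -/
theorem log_six_lt_two : Real.log 6 < 2 := by
  have h := Real.exp_one_gt_d9
  have h6 : (6 : ℝ) < Real.exp 1 * Real.exp 1 := by nlinarith
  rw [← Real.exp_add, show (1 : ℝ) + 1 = 2 by norm_num] at h6
  exact (Real.log_lt_iff_lt_exp (by norm_num)).mpr h6

/-- The bookkeeping of the constants in §10.5: with `E = e^γ ≤ 2`, `l = log 6 < 2` and
`0 < κ ≤ 1/100`, `(1+κ) (E/4)(1 − 6κ)⁻¹ (2l + κ) + (1+κ)(3κ/4) + κ ≤ E l/2 + 25κ`. [folklore] -/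
theorem mainTerm_numeric_le {κ E l : ℝ} (hκ0 : 0 < κ) (hκ1 : κ ≤ 1 / 100) (hE0 : 0 < E)
    (hE2 : E ≤ 2) (hl0 : 0 < l) (hl2 : l < 2) :
    (1 + κ) * (E / 4 * (1 / (1 - 6 * κ)) * (2 * l + κ)) + (1 + κ) * (κ / 4 * 3) + κ ≤
      E * l / 2 + 25 * κ := by
  have hfrac : (1 + κ) * (1 / (1 - 6 * κ)) ≤ 1 + 8 * κ := by
    rw [mul_one_div, div_le_iff₀ (by linarith)]; nlinarith
  have h1 : (1 + κ) * (E / 4 * (1 / (1 - 6 * κ)) * (2 * l + κ)) =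
      ((1 + κ) * (1 / (1 - 6 * κ))) * (E / 4 * (2 * l + κ)) := by ring
  have hpos : 0 ≤ E / 4 * (2 * l + κ) := by positivity
  have h2 : (1 + κ) * (E / 4 * (1 / (1 - 6 * κ)) * (2 * l + κ)) ≤
      (1 + 8 * κ) * (E / 4 * (2 * l + κ)) := by
    rw [h1]; exact mul_le_mul_of_nonneg_right hfrac hpos
  have h3 : E / 4 * (2 * l + κ) ≤ E * l / 2 + κ / 2 := by nlinarith
  have hK : E * l / 2 ≤ 2 := by nlinarith
  have h4 : (1 + 8 * κ) * (E / 4 * (2 * l + κ)) ≤ E * l / 2 + 21 * κ := by nlinarith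
  nlinarith

/-- For even `N` the Goldbach `V(z) = ∏_{p<z, p∤N} (1 − 1/(p−1))` is at least the twin
`V₂(z) = ∏_{2<p<z} (1 − 1/(p−1))` (fewer factors, all in `[0, 1]`). [folklore] -/
theorem sieveProduct_two_le_sieveProduct {N : ℕ} (hN : Even N) (w : ℝ) :
    sieveProduct 2 w ≤ sieveProduct N w := by
  unfold sieveProduct
  have hfac : ∀ p ∈ (Nat.primesBelow ⌈w⌉₊).filter (fun p : ℕ => ¬p ∣ 2),
      0 ≤ 1 - 1 / ((p : ℝ) - 1) ∧ 1 - 1 / ((p : ℝ) - 1) ≤ 1 := by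
    intro p hp
    rw [Finset.mem_filter] at hp
    have hpp := Nat.prime_of_mem_primesBelow hp.1
    have hp2 : p ≠ 2 := fun h => hp.2 (h ▸ dvd_rfl)
    have h3 : (3 : ℝ) ≤ p := by exact_mod_cast lt_of_le_of_ne hpp.two_le (Ne.symm hp2)
    constructor
    · rw [sub_nonneg, div_le_one (by linarith)]; linarith
    · have : 0 ≤ 1 / ((p : ℝ) - 1) := div_nonneg zero_le_one (by linarith)
      linarith
  refine Finset.prod_le_prod_of_subset_of_le_one ?_ (fun p hp => (hfac p hp).1)
    (fun p hp _ => (hfac p hp).2)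
  intro p hp
  rw [Finset.mem_filter] at hp ⊢
  refine ⟨hp.1, fun h2 => hp.2 ?_⟩
  have hp2 : p = 2 :=
    (Nat.prime_dvd_prime_iff_eq (Nat.prime_of_mem_primesBelow hp.1) Nat.prime_two).mp h2
  rw [hp2]; exact even_iff_two_dvd.mp hN

/-- **`V(z) ≫ 1/log N`**: for even `N ≥ 3⁸`, `V(z) ≥ V₂(z) ≥ 2e^{−7}/log z = 16e^{−7}/log N`
(crude Mertens, `sieveProduct_two_ge`; the asymptotic Thm 10.3 is not needed here). [folklore] -/
theorem sieveProduct_z_ge {N : ℕ} (hN : Even N) (hN3 : 6561 ≤ N) :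
    16 * Real.exp (-7) / Real.log N ≤ sieveProduct N (z N) := by
  have hN0 : (0 : ℝ) < N := by
    have : (6561 : ℝ) ≤ N := by exact_mod_cast hN3
    linarith
  have h1 := sieveProduct_two_ge (three_le_z hN3)
  have hlogz : Real.log (z N) = Real.log N / 8 := by rw [z, Real.log_rpow hN0]; ring
  rw [hlogz, show 2 * Real.exp (-7) / (Real.log N / 8) = 16 * Real.exp (-7) / Real.log N by
    field_simp; ring] at h1
  exact h1.trans (sieveProduct_two_le_sieveProduct hN _)

/-- The total mass `∑_{z ≤ q < y} g(q) ≤ log(8/3) + 8L₀/log N ≤ 3` for `log N ≥ 8 L₀` (Nathanson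
p. 174: `∑ 1/φ(q) = log log y − log log z + O(1/log z) = O(1)`).
[cite: Nathanson1996, Thm 10.5 (proof, p. 174)] -/
theorem sum_midPrimes_density_le {N : ℕ} (hN3 : 6561 ≤ N) (hL : 8 * (54 * Real.exp (54 / Real.log 2)) ≤ Real.log N) :
    ∑ q ∈ midPrimes (z N) (y N), shiftedPrimesDensity 2 q ≤ 3 := by
  have hN' : (6561 : ℝ) ≤ N := by exact_mod_cast hN3
  have hN0 : (0 : ℝ) < N := by linarith
  have hN1 : (1 : ℝ) ≤ N := by linarith
  have hlogN : 0 < Real.log N := Real.log_pos (by linarith)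
  have hz2 : (2 : ℝ) ≤ z N := by linarith [three_le_z hN3]
  have hzy : z N ≤ y N := by
    rw [z, y]; exact Real.rpow_le_rpow_of_exponent_le hN1 (by norm_num)
  have h := sum_shiftedPrimesDensity_two_le hz2 hzy
  have hlogz : Real.log (z N) = Real.log N / 8 := by rw [z, Real.log_rpow hN0]; ring
  have hlogy : Real.log (y N) = Real.log N / 3 := by rw [y, Real.log_rpow hN0]; ring
  have hratio : Real.log N / 3 / (Real.log N / 8) = 8 / 3 := by
    rw [div_eq_iff (by positivity)]
    ring
  rw [hlogz, hlogy, hratio] at h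
  refine h.trans ?_
  have h1 : Real.log (8 / 3 : ℝ) ≤ 8 / 3 - 1 := Real.log_le_sub_one_of_pos (by norm_num)
  have h2 : 54 * Real.exp (54 / Real.log 2) / (Real.log N / 8) ≤ 1 := by
    rw [div_le_one (by positivity)]; linarith
  linarith

/-- **Thm 10.5 for one large even `N`, from its analytic inputs** (Nathanson pp. 173–175): the
linear-sieve bound with constant `C` (Thms 9.7–9.8), Bombieri–Vinogradov at level `N^{1/2−κ}`
with `A = 3` (constant `C₃`), the prime number theorem `π(N) ≤ (1+κ)N/log N`, the main-term sum
`≤ 2 log 6 + κ`, and largeness conditions on `log N` give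
`∑_{z ≤ q < y} S(A_q, 𝒫, z) ≤ (e^γ log 6/2 + 25κ) N V(z)/log N`.
[cite: Nathanson1996, Thm 10.5 (proof, pp. 173–175)] -/
theorem sum_siftedCountDvd_le_of {N : ℕ} {κ C C₃ : ℝ} (hN : Even N) (hN3 : 6561 ≤ N)
    (hκ0 : 0 < κ) (hκ1 : κ ≤ 1 / 100) (hC0 : 0 ≤ C)
    (hC : ∀ A : SieveSequence, HasIwaniecDimension A.density 1 (54 * Real.exp (54 / Real.log 2)) →
      ∀ x y z : ℝ, 2 ≤ z → z ≤ y → Real.log y / Real.log z ≤ 3 → 0 ≤ A.size x →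
        A.sifted x (primesProdBelow z) ≤
          A.size x * A.densityProduct (primesProdBelow z) *
              (2 * Real.exp Real.eulerMascheroniConstant / (Real.log y / Real.log z) +
                C * Real.log y ^ (-(1 / 3 : ℝ))) +
            ∑ d ∈ (Finset.range ⌈y⌉₊).filter (· ∣ primesProdBelow z), |A.remainder d x|)
    (hBV : ∀ u : (m : ℕ) → (ZMod m)ˣ,
      ∑ m ∈ Finset.Icc 1 ⌊(N : ℝ) ^ (1 / 2 - κ : ℝ)⌋₊, |primeCountingDisc m (u m) N| ≤
        C₃ * N / Real.log N ^ (3 : ℝ))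
    (hπ : (Nat.primeCounting N : ℝ) ≤ (1 + κ) * ((N : ℝ) / Real.log N))
    (hS : ∑ q ∈ midPrimes (z N) (y N),
      shiftedPrimesDensity 2 q * (1 / (1 / 2 - Real.log q / Real.log N)) ≤ 2 * Real.log 6 + κ)
    (hL : 8 * (54 * Real.exp (54 / Real.log 2)) ≤ Real.log N)
    (hΛ : C * ((1 / 6 - κ) * Real.log N) ^ (-(1 / 3 : ℝ)) ≤ κ / 4)
    (hR : C₃ * N / Real.log N ^ (3 : ℝ) + (N : ℝ) ^ (1 / 2 - κ : ℝ) * N.primeFactors.card ≤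
      κ * ((N : ℝ) * sieveProduct N (z N) / Real.log N)) :
    ∑ q ∈ midPrimes (z N) (y N), (siftedCountDvd N q (z N) : ℝ) ≤
      (Real.exp Real.eulerMascheroniConstant * Real.log 6 / 2 + 25 * κ) *
        ((N : ℝ) * sieveProduct N (z N) / Real.log N) := by
  classical
  have hN' : (6561 : ℝ) ≤ N := by exact_mod_cast hN3
  have hN0 : (0 : ℝ) < N := by linarith
  have hlogN : 0 < Real.log N := Real.log_pos (by linarith)
  -- notation
  set Q := midPrimes (z N) (y N) with hQ
  set Q' := Q.filter (fun q => ¬q ∣ N) with hQ'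
  set V := sieveProduct N (z N) with hV
  set X := (N : ℝ) * V / Real.log N with hX
  set P := (Nat.primeCounting N : ℝ) with hP
  set E := Real.exp Real.eulerMascheroniConstant with hE
  set c₁ := E / 4 * (1 / (1 - 6 * κ)) with hc₁
  set Λ := ((1 / 6 - κ) * Real.log N) ^ (-(1 / 3 : ℝ)) with hΛdef
  set g : ℕ → ℝ := fun q => shiftedPrimesDensity 2 q with hg
  set φ : ℕ → ℝ := fun q => 1 / (1 / 2 - Real.log q / Real.log N) with hφ
  set D := (N : ℝ) ^ (1 / 2 - κ : ℝ) with hD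
  set Rs : ℕ → ℝ := fun q => ∑ d ∈ (Finset.range ⌈D / q⌉₊).filter (· ∣ primesProdBelow (z N)),
    |(goldbachSeq N q).remainder d N| with hRs
  -- signs
  have hV0 : 0 < V := by
    have h1 := sieveProduct_z_ge hN hN3
    have h2 : 0 < 16 * Real.exp (-7) / Real.log N := by positivity
    exact lt_of_lt_of_le h2 h1
  have hX0 : 0 < X := by rw [hX]; exact div_pos (mul_pos hN0 hV0) hlogN
  have hE0 : 0 < E := Real.exp_pos _
  have hE2 : E ≤ 2 := exp_eulerMascheroni_le_two
  have hc₁0 : 0 ≤ c₁ := by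
    have : 0 < 1 - 6 * κ := by linarith
    rw [hc₁]; positivity
  have hΛ0 : 0 ≤ Λ := Real.rpow_nonneg (mul_nonneg (by linarith) hlogN.le) _
  have hg0 : ∀ q ∈ Q, 0 ≤ g q := fun q hq =>
    (shiftedPrimesDensity_two_prime_mem_Ico (Nat.prime_of_mem_primesBelow (Finset.mem_filter.mp hq).1)).1
  have hφ0 : ∀ q ∈ Q, 0 ≤ φ q := by
    intro q hq
    obtain ⟨hqmem, -⟩ := Finset.mem_filter.mp hq
    rw [Nat.mem_primesBelow, Nat.lt_ceil] at hqmem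
    have hq0 : (0 : ℝ) < q := by exact_mod_cast hqmem.2.pos
    have h1 : Real.log q < Real.log N / 3 := by
      have := Real.log_lt_log hq0 hqmem.1
      rwa [y, Real.log_rpow hN0, one_div_mul_eq_div] at this
    have h2 : Real.log q / Real.log N < 1 / 3 := by
      rw [div_lt_iff₀ hlogN]; linarith
    exact div_nonneg zero_le_one (by linarith)
  -- Step 1: the primes `q ∣ N` contribute nothing
  have hstep1 : ∑ q ∈ Q, (siftedCountDvd N q (z N) : ℝ) =
      ∑ q ∈ Q', (siftedCountDvd N q (z N) : ℝ) := by
    rw [hQ', ← Finset.sum_filter_add_sum_filter_not Q (fun q => ¬q ∣ N)]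
    have : ∑ q ∈ Q.filter (fun q => ¬¬q ∣ N), (siftedCountDvd N q (z N) : ℝ) = 0 :=
      Finset.sum_eq_zero fun q hq => by
        rw [Finset.mem_filter, not_not] at hq
        rw [siftedCountDvd_eq_zero_of_dvd
          (Nat.prime_of_mem_primesBelow (Finset.mem_filter.mp hq.1).1) hq.2, Nat.cast_zero]
    rw [this, add_zero]
  -- Step 2: the sieve bound for each `q ∈ Q'`, summed
  have hstep2 : ∀ q ∈ Q', (siftedCountDvd N q (z N) : ℝ) ≤
      P * V * g q * (c₁ * φ q + C * Λ) + Rs q := fun q hq =>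
    siftedCountDvd_le_of_sieve hN hN3 hκ0.le (by linarith) hC0 hC (Finset.mem_filter.mp hq).1
  have hQ'sub : Q' ⊆ Q := Finset.filter_subset _ _
  have hsum2 : ∑ q ∈ Q', (siftedCountDvd N q (z N) : ℝ) ≤
      P * V * (c₁ * ∑ q ∈ Q', g q * φ q + C * Λ * ∑ q ∈ Q', g q) + ∑ q ∈ Q', Rs q := by
    refine (Finset.sum_le_sum hstep2).trans (le_of_eq ?_)
    have e1 : ∀ q ∈ Q', P * V * g q * (c₁ * φ q + C * Λ) + Rs q =
        (P * V * c₁ * (g q * φ q) + P * V * (C * Λ) * g q) + Rs q := fun q _ => by ring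
    rw [Finset.sum_congr rfl e1, Finset.sum_add_distrib, Finset.sum_add_distrib,
      ← Finset.mul_sum, ← Finset.mul_sum]
    ring
  -- Step 3: the two `q`-sums
  have hS1 : ∑ q ∈ Q', g q * φ q ≤ 2 * Real.log 6 + κ :=
    (Finset.sum_le_sum_of_subset_of_nonneg hQ'sub fun q hq _ =>
      mul_nonneg (hg0 q hq) (hφ0 q hq)).trans hS
  have hS0 : ∑ q ∈ Q', g q ≤ 3 :=
    (Finset.sum_le_sum_of_subset_of_nonneg hQ'sub fun q hq _ => hg0 q hq).trans
      (sum_midPrimes_density_le hN3 hL)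
  have hS00 : 0 ≤ ∑ q ∈ Q', g q := Finset.sum_nonneg fun q hq => hg0 q (hQ'sub hq)
  -- Step 4: the remainders
  have hstep4 : ∑ q ∈ Q', Rs q ≤ κ * X := by
    have hQ'mem : ∀ q ∈ Q', q.Prime ∧ ¬q ∣ N ∧ z N ≤ (q : ℝ) := fun q hq => by
      obtain ⟨hq1, hq2⟩ := Finset.mem_filter.mp hq
      obtain ⟨hq3, hq4⟩ := Finset.mem_filter.mp hq1
      exact ⟨Nat.prime_of_mem_primesBelow hq3, hq2, hq4⟩
    let u : (m : ℕ) → (ZMod m)ˣ := fun m => if h : N.Coprime m then ZMod.unitOfCoprime N h else 1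
    have hu' : ∀ m : ℕ, (h : N.Coprime m) → u m = ZMod.unitOfCoprime N h := fun m h => dif_pos h
    have h1 : ∑ q ∈ Q', Rs q ≤
        ∑ q ∈ Q', ∑ d ∈ ((Finset.range ⌈D / q⌉₊).filter (· ∣ primesProdBelow (z N))).filter
          (fun d => d.Coprime N),
          (|primeCountingDisc (q * d) (N : ZMod (q * d)) N| + (N.primeFactors.card : ℝ)) :=
      Finset.sum_le_sum fun q hq => by
        obtain ⟨hqp, hqN, hzq⟩ := hQ'mem q hq
        exact remainderSum_goldbachSeq_le hqp hqN hzq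
    have h2 := sum_remainderSum_le (w := z N) (D := D) (Real.rpow_nonneg hN0.le _) Q' hQ'mem u hu'
    have h3 := hBV u
    exact h1.trans (h2.trans (le_trans (by linarith only [h3]) hR))
  -- Step 5: the main terms
  have hPX : P * V ≤ (1 + κ) * X := by
    have : P * V ≤ (1 + κ) * ((N : ℝ) / Real.log N) * V := mul_le_mul_of_nonneg_right hπ hV0.le
    rw [hX]
    calc P * V ≤ (1 + κ) * ((N : ℝ) / Real.log N) * V := this
      _ = (1 + κ) * (N * V / Real.log N) := by ring
  have hPV0 : 0 ≤ P * V := mul_nonneg (Nat.cast_nonneg _) hV0.le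
  have hS10 : 0 ≤ ∑ q ∈ Q', g q * φ q :=
    Finset.sum_nonneg fun q hq => mul_nonneg (hg0 q (hQ'sub hq)) (hφ0 q (hQ'sub hq))
  have hκX0 : 0 ≤ (1 + κ) * X := mul_nonneg (by linarith only [hκ0]) hX0.le
  have hmainA : P * V * (c₁ * ∑ q ∈ Q', g q * φ q) ≤ (1 + κ) * X * (c₁ * (2 * Real.log 6 + κ)) :=
    mul_le_mul hPX (mul_le_mul_of_nonneg_left hS1 hc₁0) (mul_nonneg hc₁0 hS10) hκX0
  have hmainB : P * V * (C * Λ * ∑ q ∈ Q', g q) ≤ (1 + κ) * X * (κ / 4 * 3) :=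
    mul_le_mul hPX (mul_le_mul hΛ hS0 hS00 (by linarith only [hκ0]))
      (mul_nonneg (mul_nonneg hC0 hΛ0) hS00) hκX0
  -- Step 6: numerics
  have hnum : (1 + κ) * (c₁ * (2 * Real.log 6 + κ)) + (1 + κ) * (κ / 4 * 3) + κ ≤
      E * Real.log 6 / 2 + 25 * κ := by
    have := mainTerm_numeric_le hκ0 hκ1 hE0 hE2 (Real.log_pos (by norm_num)) log_six_lt_two
    rw [hc₁]; linarith only [this]
  -- conclusion
  calc ∑ q ∈ Q, (siftedCountDvd N q (z N) : ℝ)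
      = ∑ q ∈ Q', (siftedCountDvd N q (z N) : ℝ) := hstep1
    _ ≤ P * V * (c₁ * ∑ q ∈ Q', g q * φ q + C * Λ * ∑ q ∈ Q', g q) + ∑ q ∈ Q', Rs q := hsum2
    _ = P * V * (c₁ * ∑ q ∈ Q', g q * φ q) + P * V * (C * Λ * ∑ q ∈ Q', g q) +
          ∑ q ∈ Q', Rs q := by ring
    _ ≤ (1 + κ) * X * (c₁ * (2 * Real.log 6 + κ)) + (1 + κ) * X * (κ / 4 * 3) + κ * X := by
        linarith only [hmainA, hmainB, hstep4]
    _ = ((1 + κ) * (c₁ * (2 * Real.log 6 + κ)) + (1 + κ) * (κ / 4 * 3) + κ) * X := by ring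
    _ ≤ (E * Real.log 6 / 2 + 25 * κ) * X := mul_le_mul_of_nonneg_right hnum hX0.le

/-- `(log N)^3 N^{1/2} ≤ c N` for large `N` (any `c > 0`). [folklore] -/
theorem eventually_log_cube_mul_sqrt_le {c : ℝ} (hc : 0 < c) :
    ∀ᶠ N : ℕ in atTop, Real.log N ^ 3 * (N : ℝ) ^ (1 / 2 : ℝ) ≤ c * N := by
  have h := (isLittleO_log_rpow_rpow_atTop (3 : ℝ) (show (0 : ℝ) < 1 / 2 by norm_num)).bound hc
  filter_upwards [(tendsto_natCast_atTop_atTop (R := ℝ)).eventually h, eventually_ge_atTop 1]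
    with N hN hN1
  have hN0 : (0 : ℝ) ≤ N := Nat.cast_nonneg N
  rw [Real.norm_eq_abs, Real.norm_eq_abs, show (3 : ℝ) = ((3 : ℕ) : ℝ) by norm_num,
    Real.rpow_natCast, abs_of_nonneg (pow_nonneg (Real.log_nonneg (by exact_mod_cast hN1)) 3),
    abs_of_nonneg (Real.rpow_nonneg hN0 _)] at hN
  calc Real.log N ^ 3 * (N : ℝ) ^ (1 / 2 : ℝ)
      ≤ c * (N : ℝ) ^ (1 / 2 : ℝ) * (N : ℝ) ^ (1 / 2 : ℝ) :=
        mul_le_mul_of_nonneg_right hN (Real.rpow_nonneg hN0 _)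
    _ = c * N := by
        rw [mul_assoc, ← Real.rpow_add' hN0 (by norm_num)]; norm_num

/-- The error-term constant is eventually small: `C ((1/6 − κ) log N)^{−1/3} ≤ κ/4` as soon as
`log N ≥ 8 ((4C+1)/κ)³`. [folklore] -/
theorem errorCoeff_le {C κ L : ℝ} (hC0 : 0 ≤ C) (hκ0 : 0 < κ) (hκ1 : κ ≤ 1 / 24)
    (hL : 8 * ((4 * C + 1) / κ) ^ 3 ≤ L) :
    C * ((1 / 6 - κ) * L) ^ (-(1 / 3 : ℝ)) ≤ κ / 4 := by
  set M := (4 * C + 1) / κ with hM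
  have hM0 : 0 < M := by rw [hM]; positivity
  have hL0 : 0 < L := lt_of_lt_of_le (by positivity) hL
  have h1 : M ^ 3 ≤ (1 / 6 - κ) * L := by
    have : (1 / 8 : ℝ) * L ≤ (1 / 6 - κ) * L := mul_le_mul_of_nonneg_right (by linarith) hL0.le
    linarith
  have h2 : ((1 / 6 - κ) * L) ^ (-(1 / 3 : ℝ)) ≤ (M ^ 3) ^ (-(1 / 3 : ℝ)) :=
    Real.rpow_le_rpow_of_nonpos (by positivity) h1 (by norm_num)
  have h3 : (M ^ 3) ^ (-(1 / 3 : ℝ)) = M⁻¹ := by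
    rw [show M ^ 3 = M ^ (3 : ℝ) by norm_cast, ← Real.rpow_mul hM0.le,
      show (3 : ℝ) * (-(1 / 3)) = -1 by norm_num, Real.rpow_neg_one]
  rw [h3] at h2
  calc C * ((1 / 6 - κ) * L) ^ (-(1 / 3 : ℝ)) ≤ C * M⁻¹ := mul_le_mul_of_nonneg_left h2 hC0
    _ ≤ κ / 4 := by
        rw [hM, inv_div, ← mul_div_assoc, div_le_div_iff₀ (by positivity) (by norm_num)]
        nlinarith

/-- The remainder budget is eventually available: if `max(C₃,0) e⁷/(8κ) ≤ log N` and
`(log N)³ N^{1/2} ≤ 4κe^{−7} N`, then for even `N ≥ 3⁸`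
`C₃ N/(log N)³ + N^{1/2−κ} ω(N) ≤ κ N V(z)/log N` (using `V(z) ≥ 16e^{−7}/log N` and
`ω(N) ≤ 2 log N`). [folklore] -/
theorem remainderBudget_le {N : ℕ} {κ C₃ : ℝ} (hN : Even N) (hN3 : 6561 ≤ N) (hκ0 : 0 < κ)
    (hlog3 : max C₃ 0 * Real.exp 7 / (8 * κ) ≤ Real.log N)
    (hE7 : Real.log N ^ 3 * (N : ℝ) ^ (1 / 2 : ℝ) ≤ 4 * κ * Real.exp (-7) * N) :
    C₃ * N / Real.log N ^ (3 : ℝ) + (N : ℝ) ^ (1 / 2 - κ : ℝ) * N.primeFactors.card ≤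
      κ * ((N : ℝ) * sieveProduct N (z N) / Real.log N) := by
  have hN' : (6561 : ℝ) ≤ N := by exact_mod_cast hN3
  have hN0 : (0 : ℝ) < N := by linarith
  have hN1 : N ≠ 0 := by omega
  have hlogN : 0 < Real.log N := Real.log_pos (by linarith)
  set W := 16 * Real.exp (-7) * N / Real.log N ^ 2 with hW
  have hX : W ≤ (N : ℝ) * sieveProduct N (z N) / Real.log N := by
    have := mul_le_mul_of_nonneg_left (sieveProduct_z_ge hN hN3) hN0.le
    calc W = (N : ℝ) * (16 * Real.exp (-7) / Real.log N) / Real.log N := by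
          rw [hW]; field_simp
      _ ≤ (N : ℝ) * sieveProduct N (z N) / Real.log N := div_le_div_of_nonneg_right this hlogN.le
  -- first term
  have hA : C₃ * N / Real.log N ^ (3 : ℝ) ≤ κ / 2 * W := by
    rw [show (3 : ℝ) = ((3 : ℕ) : ℝ) by norm_num, Real.rpow_natCast]
    have h1 : C₃ * N / Real.log N ^ 3 ≤ max C₃ 0 * N / Real.log N ^ 3 := by
      gcongr; exact le_max_left _ _
    refine h1.trans ?_
    rw [div_le_iff₀ (by positivity), hW]
    have h77 : Real.exp (-7) * Real.exp 7 = 1 := by rw [← Real.exp_add]; norm_num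
    have h2 : max C₃ 0 * Real.exp 7 ≤ 8 * κ * Real.log N := by
      have h5 := (div_le_iff₀ (show (0 : ℝ) < 8 * κ by positivity)).mp hlog3
      linarith
    have h3 : max C₃ 0 = max C₃ 0 * Real.exp 7 * Real.exp (-7) := by
      rw [mul_assoc, mul_comm (Real.exp 7), h77, mul_one]
    calc max C₃ 0 * N = max C₃ 0 * Real.exp 7 * Real.exp (-7) * N := by rw [← h3]
      _ ≤ 8 * κ * Real.log N * Real.exp (-7) * N := by gcongr
      _ = κ / 2 * (16 * Real.exp (-7) * N / Real.log N ^ 2) * Real.log N ^ 3 := by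
          field_simp; ring
  -- second term
  have hB : (N : ℝ) ^ (1 / 2 - κ : ℝ) * N.primeFactors.card ≤ κ / 2 * W := by
    have hω := card_primeFactors_le_two_mul_log hN1
    have hpow : (N : ℝ) ^ (1 / 2 - κ : ℝ) ≤ (N : ℝ) ^ (1 / 2 : ℝ) :=
      Real.rpow_le_rpow_of_exponent_le (by linarith) (by linarith)
    calc (N : ℝ) ^ (1 / 2 - κ : ℝ) * N.primeFactors.card
        ≤ (N : ℝ) ^ (1 / 2 : ℝ) * (2 * Real.log N) :=
          mul_le_mul hpow hω (Nat.cast_nonneg _) (Real.rpow_nonneg hN0.le _)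
      _ = 2 * (Real.log N ^ 3 * (N : ℝ) ^ (1 / 2 : ℝ)) / Real.log N ^ 2 := by
          rw [eq_div_iff (by positivity)]; ring
      _ ≤ 2 * (4 * κ * Real.exp (-7) * N) / Real.log N ^ 2 := by gcongr
      _ = κ / 2 * W := by rw [hW]; ring
  have hκW := mul_le_mul_of_nonneg_left hX hκ0.le
  linarith

/-- **Nathanson's Theorem 10.5, PROVED**: for every `ε > 0` and all large even `N`,
`∑_{z ≤ q < y} S(A_q, 𝒫, z) < (e^γ log 6/2 + ε) N V(z)/log N` (`z = N^{1/8}`, `y = N^{1/3}`).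
Discharge of the named fact `chen_siftedDvd_upper` of `ChenTheorem.lean`, from the linear sieve
(Iwaniec's Theorem 1 with `F(s) = 2e^γ/s`, proved in the tree), the Bombieri–Vinogradov theorem
(`BombieriVinogradovStatement_holds`), the prime number theorem and Mertens' theorem.
[cite: Nathanson1996, Thm 10.5] -/
theorem chen_siftedDvd_upper_holds : chen_siftedDvd_upper := by
  intro ε hε
  -- the small parameter
  set κ : ℝ := min ε 1 / 100 with hκ
  have hmin0 : 0 < min ε 1 := lt_min hε one_pos
  have hκ0 : 0 < κ := by rw [hκ]; positivity
  have hκ1 : κ ≤ 1 / 100 := by have := min_le_right ε 1; rw [hκ]; linarith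
  have hκε : 100 * κ ≤ ε := by have := min_le_left ε 1; rw [hκ]; linarith
  -- the inputs
  obtain ⟨C, hC0, hC⟩ := linearSieve_upper_le (54 * Real.exp (54 / Real.log 2))
  obtain ⟨C₃, hBV⟩ := eventually_sum_abs_primeCountingDisc_le BombieriVinogradovStatement_holds
    (θ₁ := 1 / 2 - κ) (by linarith) (A := 3) (by norm_num)
  obtain ⟨N₁, hN₁⟩ := sum_midPrimes_density_mul_phi_le hκ0
  have hπ := eventually_primeCounting_bounds hκ0
  have hlog : Tendsto (fun N : ℕ => Real.log N) atTop atTop :=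
    Real.tendsto_log_atTop.comp (tendsto_natCast_atTop_atTop (R := ℝ))
  have hE7 := eventually_log_cube_mul_sqrt_le (c := 4 * κ * Real.exp (-7)) (by positivity)
  obtain ⟨N₀, hN₀⟩ := eventually_atTop.mp (hBV.and (hπ.and
    ((hlog.eventually_ge_atTop (8 * (54 * Real.exp (54 / Real.log 2)))).and
    ((hlog.eventually_ge_atTop (8 * ((4 * C + 1) / κ) ^ 3)).and
    ((hlog.eventually_ge_atTop (max C₃ 0 * Real.exp 7 / (8 * κ))).and
    (hE7.and ((eventually_ge_atTop N₁).and (eventually_ge_atTop 6561))))))))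
  refine ⟨N₀, fun N hN hEven => ?_⟩
  obtain ⟨hBVN, ⟨-, hπN⟩, hL, hlog2, hlog3, hE7N, hNN₁, hN3⟩ := hN₀ N hN
  have hN' : (6561 : ℝ) ≤ N := by exact_mod_cast hN3
  have hN0 : (0 : ℝ) < N := by linarith
  have hlogN : 0 < Real.log N := Real.log_pos (by linarith)
  have hΛ := errorCoeff_le hC0 hκ0 (by linarith) hlog2
  have hR := remainderBudget_le hEven hN3 hκ0 hlog3 hE7N
  have hmain := sum_siftedCountDvd_le_of hEven hN3 hκ0 hκ1 hC0 hC hBVN hπN (hN₁ N hNN₁) hL hΛ hR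
  have hXpos : 0 < (N : ℝ) * sieveProduct N (z N) / Real.log N := by
    have hV : 0 < sieveProduct N (z N) :=
      lt_of_lt_of_le (by positivity) (sieveProduct_z_ge hEven hN3)
    positivity
  refine hmain.trans_lt (mul_lt_mul_of_pos_right ?_ hXpos)
  linarith

end Literature.NumberTheory.Sieve.Chen
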